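import Mathlib
import HarnessLib
import HarnessLib.Audit
import Summits.ValiantsHypothesis.Statement
import Literature.Computability.Complexity.ConstantDepth
import Literature.Computability.Complexity.ACRealizeOver
import Literature.Computability.MetaComplexity.SmolenskyMajority
import Literature.Computability.AlgebraicComplexity.CircuitDepth
import Literature.Computability.AlgebraicComplexity.ValiantBooleanBridge
import Literature.Computability.AlgebraicComplexity.ArithCircuitProjections
import Summits.ValiantsHypothesis.ValiantsHypothesis.Theorems.SuccinctLiftIntegerAdvice
import Summits.ValiantsHypothesis.ValiantsHypothesis.Theorems.SuccinctLiftAlgebraicConstants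
import HarnessLib.Audit.Status.Attr

/-!
Route: SuccinctLift

# Route SuccinctLift — VH from the succinctness × product-depth quadrant — per hard for √N-succinct
constant-free circuits of depth log log log n, AND the uniformity lift, the constant lift and the
collapse to that depth

X = A ∧ U ∧ K ∧ B, four pieces, each NECESSARY for VH — KERNEL, no hypothesis: `summit_iff_split4' :
VH ↔ A ∧ U ∧ K ∧ B` in the lens file,
using the landed
`Summit.ValiantsHypothesis.ValiantsHypothesis.Theorems.DepthWindow.binarisationBound` (lens-4 g2,
p739322) — and each
STRICTLY WEAKER as far as anyone knows. Read lens-4's crux `PerHardLog3` (item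
stmt-ValiantsHypothesis-23549: per_n has no poly-wire unbounded-fan-in circuits over ℂ of
product-depth ≤ Δ₁(n) = ⌊log₂⌊log₂⌊log₂ n⌋⌋⌋+1)
through two further dials — CONSTANTS (sign constants 0, ±1 only: integer circuits `ArithCircuit ℤ
(Fin (n·n))` with `HasSignConstants`,
complexified by `map (Int.castRingHom ℂ)` and `rename finProdFinEquiv.symm`) and SUCCINCTNESS of the
circuit's Kabanets–Impagliazzo code word
`encodeArithCircuit` (in tree, injective): the bit `code[i]` is computed from `i` in binary by a
`B₂`-circuit with at most n + c gates
(n = √N for N = n² inputs). A = `SuccinctPerHardLog3`: no such (n+c)-succinct constant-free depth-Δ₁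
poly-wire family computes per.
U = `UniformityLiftLog3`: A ⟹ the same without the succinctness clause (`PerHardLog3CF`, aside). K =
`ConstantLiftLog3`: constant-free
hardness ⟹ `PerHardLog3`. B = `CollapseLog3` (lens-4's residual, item stmt-ValiantsHypothesis-23550,
shared verbatim). Kernel facts
(lens file SuccinctLift.lean, 0 sorry): `perHardLog3_iff_split3 : PerHardLog3 ↔ A ∧ U ∧ K`,
`summit_iff_split4' : VH ↔ A ∧ U ∧ K ∧ B`,
`succinctCollapseLog3_iff_walls' : (VP=VNP → succinct circuits) ↔ U ∧ K ∧ B` = the residual of A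
factored into three walls (all
without hypotheses). Decomposition workshop node (decomp-valiant cycle 1, lens 2
natural-proofs/succinctness, gen 2); no idea card.
Lean: `(¬ ∃ c : ℕ, ∀ n : ℕ, ∃ C : Literature.Computability.AlgebraicComplexity.ArithCircuit ℤ (Fin
(n * n)), ∃ C' : Literature.Computability.AlgebraicComplexity.ArithCircuit ℂ (Fin n × Fin n), C' =
(C.map (Int.castRingHom ℂ)).rename ⇑(finProdFinEquiv (m := n) (n := n)).symm ∧ C.HasSignConstants ∧
C'.Computes (Literature.Computability.AlgebraicComplexity.perPoly (Fin n) ℂ) ∧ C'.productDepth ≤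
Nat.log 2 (Nat.log 2 (Nat.log 2 n)) + 1 ∧ C'.edgeSize ≤ n ^ c + c ∧ ∃ w : ℕ,
(Literature.Computability.AlgebraicComplexity.encodeArithCircuit (n * n) C).length ≤ 2 ^ w ∧ ∃ D :
Literature.Computability.Complexity.Circuit (Fin w), D.IsOver Literature.Computability.Complexity.B2
∧ D.size ≤ n + c ∧ D.Computes fun a =>
(Literature.Computability.AlgebraicComplexity.encodeArithCircuit (n * n) C).getD (∑ t : Fin w, if a
t then 2 ^ (t : ℕ) else 0) false) ∧ ((¬ ∃ c : ℕ, ∀ n : ℕ, ∃ C :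
Literature.Computability.AlgebraicComplexity.ArithCircuit ℤ (Fin (n * n)), ∃ C' :
Literature.Computability.AlgebraicComplexity.ArithCircuit ℂ (Fin n × Fin n), C' = (C.map
(Int.castRingHom ℂ)).rename ⇑(finProdFinEquiv (m := n) (n := n)).symm ∧ C.HasSignConstants ∧
C'.Computes (Literature.Computability.AlgebraicComplexity.perPoly (Fin n) ℂ) ∧ C'.productDepth ≤
Nat.log 2 (Nat.log 2 (Nat.log 2 n)) + 1 ∧ C'.edgeSize ≤ n ^ c + c ∧ ∃ w : ℕ,
(Literature.Computability.AlgebraicComplexity.encodeArithCircuit (n * n) C).length ≤ 2 ^ w ∧ ∃ D :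
Literature.Computability.Complexity.Circuit (Fin w), D.IsOver Literature.Computability.Complexity.B2
∧ D.size ≤ n + c ∧ D.Computes fun a =>
(Literature.Computability.AlgebraicComplexity.encodeArithCircuit (n * n) C).getD (∑ t : Fin w, if a
t then 2 ^ (t : ℕ) else 0) false) → ¬ ∃ c : ℕ, ∀ n : ℕ, ∃ C :
Literature.Computability.AlgebraicComplexity.ArithCircuit ℤ (Fin (n * n)), ∃ C' :
Literature.Computability.AlgebraicComplexity.ArithCircuit ℂ (Fin n × Fin n), C' = (C.map
(Int.castRingHom ℂ)).rename ⇑(finProdFinEquiv (m := n) (n := n)).symm ∧ C.HasSignConstants ∧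
C'.Computes (Literature.Computability.AlgebraicComplexity.perPoly (Fin n) ℂ) ∧ C'.productDepth ≤
Nat.log 2 (Nat.log 2 (Nat.log 2 n)) + 1 ∧ C'.edgeSize ≤ n ^ c + c) ∧ ((¬ ∃ c : ℕ, ∀ n : ℕ, ∃ C :
Literature.Computability.AlgebraicComplexity.ArithCircuit ℤ (Fin (n * n)), ∃ C' :
Literature.Computability.AlgebraicComplexity.ArithCircuit ℂ (Fin n × Fin n), C' = (C.map
(Int.castRingHom ℂ)).rename ⇑(finProdFinEquiv (m := n) (n := n)).symm ∧ C.HasSignConstants ∧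
C'.Computes (Literature.Computability.AlgebraicComplexity.perPoly (Fin n) ℂ) ∧ C'.productDepth ≤
Nat.log 2 (Nat.log 2 (Nat.log 2 n)) + 1 ∧ C'.edgeSize ≤ n ^ c + c) → ¬ ∃ c : ℕ, ∀ n : ℕ, ∃ C :
Literature.Computability.AlgebraicComplexity.ArithCircuit ℂ (Fin n × Fin n), C.Computes
(Literature.Computability.AlgebraicComplexity.perPoly (Fin n) ℂ) ∧ C.productDepth ≤ Nat.log 2
(Nat.log 2 (Nat.log 2 n)) + 1 ∧ C.edgeSize ≤ n ^ c + c) ∧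
(Literature.Computability.AlgebraicComplexity.VP ℂ =
Literature.Computability.AlgebraicComplexity.VNP ℂ → ∃ c : ℕ, ∀ n : ℕ, ∃ C :
Literature.Computability.AlgebraicComplexity.ArithCircuit ℂ (Fin n × Fin n), C.Computes
(Literature.Computability.AlgebraicComplexity.perPoly (Fin n) ℂ) ∧ C.productDepth ≤ Nat.log 2
(Nat.log 2 (Nat.log 2 n)) + 1 ∧ C.edgeSize ≤ n ^ c + c)`

Rationale: WHY THIS LINE. The only lower bounds for the permanent that escape BOTH catalogued barrier classes
of this summit — algebraically natural proofs
(ForbesShpilkaVolk2018, GrochowKumarSaksSaraf2017) and rank/measure methods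
(Literature.Barriers.ValiantsHypothesis.RankMethods,
BhargavDuttaSaxena2024 Thm 1.7) — are the UNIFORM ones proved by (indirect) diagonalisation:
Allender1999 (uniform TC⁰), KoiranPerifel2009
Cor. 7 (polynomial-time-uniform arithmetic circuits of depth o(log log n)), JansenSanthanam2013 and
ChenKabanets2012 Thm 1.1–1.3 (succinct /
poly(m)-weakly-uniform threshold or constant-free arithmetic circuits: constant depth with
subexponential advice, depth o(log log n) with
polynomial advice). They live on a SUCCINCTNESS axis that no current route types (census v2 row H8:
uniformity is the one hypothesis-side
weakening that is strictly weaker, non-natural and attackable). This route types that axis inside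
lens-4's depth window: reading
ChenKabanets2012 Lemmas 2.4/3.1/3.3/3.4 at depth Δ₁ (NOTES §CK12-extrapolation) the printed method
reaches description budgets 2^(m^(1−ε))
(m = log size) but not 2^(εm); the budget n + c = 2^(Θ(m/c)) of A is the first notch outside it, so
A is open, adjacent to a working
non-natural technique, and implied by VH; its residual is not one opaque statement but U ∧ K ∧ B,
two of which (U: uniform-to-nonuniform
lift, cf. hardness magnification McKayMurrayWilliams2019 / CHOPRS2020; K: elimination of constants
at fixed product-depth, Burgisser2000
Ch. 4, Koiran2004, KoiranPerifel2011) are classical named walls now stated as typed per-specific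
implications. Imported area: Boolean
uniform complexity / diagonalisation (the dictionary is ChenKabanets2012 Lemma 2.2: constant-free
arithmetic circuit of depth d ↦ threshold
circuit of depth O(d), description size preserved up to a polynomial). Nothing in the negatives
index concerns uniformity or constants.

RANKED CRUXES. #2 SuccinctPerHardLog3 (crux) — A (ATTACKABLE leaf, WEAKER — kernel
`succinctPerHardLog3_of_vh`, no hypothesis; UNDECIDED-with-test: does the general trade-off of
Chen–Kabanets–Kinne (Algorithmica 2013, acq-07423) or Kinne2012 (acq-14740) already cover advice
2^(εm) at depth log log log n? our reading of ChenKabanets2012 §3–4 says no): for no constant c is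
there, for every n, an integer circuit C on n² variables with sign constants whose complexification
computes per_n ∈ ℂ[x_ij] within product-depth ⌊log₂⌊log₂⌊log₂ n⌋⌋⌋+1 and n^c + c wires AND whose
code word `encodeArithCircuit (n·n) C` is (n+c)-succinct (some B₂-circuit with ≤ n + c gates maps an
address i, in binary on w bits with |code| ≤ 2^w, to bit i of the code). [difficulty: L] (why it
might fail: False iff per HAS √N-succinct constant-free depth-logloglog poly circuits (then VH fails
too); the risk is vacuity of novelty: a CK12/Kinne-type trade-off may already prove it (then A is a
theorem and the node is U ∧ K ∧ B).) [ChenKabanets2012, JansenSanthanam2013, KoiranPerifel2009,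
Kinne2012, Allender1999]
#3 UniformityLiftLog3 (crux) — U (declared-RESIDUAL factor 1, IDEA-NEEDED / BARRIER leaf, WEAKER —
kernel `uniformityLiftLog3_of_vh`, since VH gives its conclusion): if per has no (n+c)-succinct
constant-free depth-Δ₁ poly-wire circuits then it has no constant-free depth-Δ₁ poly-wire circuits
at all. Contrapositive: any constant-free depth-Δ₁ poly family for per can be replaced by one whose
description compresses to n + c gates — a per-specific uniform-to-nonuniform ("hardness
magnification in the description budget") statement; `perHardLog3CF_iff_split2 : PerHardLog3CF ↔ A ∧
U` (kernel). [difficulty: open-problem] (why it might fail: No uniform→non-uniform lifting theorem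
is known for any explicit polynomial; the locality barrier (CHOPRS2020) kills the generic
magnification route; fails iff per has CF depth-Δ₁ poly circuits but only incompressible ones.)
[CHOPRS2020, McKayMurrayWilliams2019, ChenKabanets2012, ChatterjeeTengse2023]
#4 ConstantLiftLog3 (crux) — K (declared-RESIDUAL factor 2, IDEA-NEEDED leaf, WEAKER — kernel
`constantLiftLog3_of_vh`): if per has no constant-free (sign constants, integer) depth-Δ₁ poly-wire
circuits then it has no depth-Δ₁ poly-wire circuits over ℂ with arbitrary constants, i.e. lens-4's
`PerHardLog3`. Constant elimination at FIXED product-depth for the permanent;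
`perHardLog3_iff_split3 : PerHardLog3 ↔ A ∧ U ∧ K` (kernel, no hypothesis). [difficulty:
open-problem] (why it might fail: Eliminating complex constants is open even without a depth
constraint (VP=VNP over ℂ vs τ(per): Burgisser2000 Ch. 4, Koiran2004); algebraic constants of
exponential degree have no known depth-preserving removal; fails iff constants genuinely shorten per
at depth Δ₁.) [Burgisser2000, Koiran2004, KoiranPerifel2011, Burgisser2009]
#5 CollapseLog3 (crux) — B (declared-RESIDUAL factor 3 = lens-4's residual, item
stmt-ValiantsHypothesis-23550 shared verbatim; IDEA-NEEDED leaf; WEAKER, kernel and vacuous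
`collapseToDepth_of_vh`): if VP_ℂ = VNP_ℂ then for some c every per_n has an unbounded-fan-in
circuit over ℂ of product-depth ≤ ⌊log₂⌊log₂⌊log₂ n⌋⌋⌋+1 with at most n^c + c wires. Here it is the
third wall of A's residual: `succinctCollapseLog3_iff_walls' : SuccinctCollapseLog3 ↔ U ∧ K ∧ B`.
[difficulty: open-problem] (why it might fail: Depth reduction below Θ(log d) costs n^Θ(d^(1/Δ))
unconditionally and nobody has used VP=VNP to shorten product-depth for the complete family; false
iff VP=VNP yet per (equivalently IMM) is hard at depth Δ₁.) [ValiantSkyumBerkowitzRackoff1983,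
Tavenas2015, Burgisser2000, LimayeSrinivasanTavenas2025]
#9 PerHardLog3 (support) — lens-4's crux A (item stmt-ValiantsHypothesis-23549, verbatim; banked
context here, staffed on route-ValiantsHypothesis-DepthWindow / DecompCycle1B): the hub this route
splits, `perHardLog3_iff_split3 : PerHardLog3 ↔ SuccinctPerHardLog3 ∧ UniformityLiftLog3 ∧
ConstantLiftLog3` (kernel, no hypothesis). [difficulty: open-problem] [LimayeSrinivasanTavenas2025,
BhargavDuttaSaxena2024]
#9 PerHardLog3CF (support) — the constant-free intermediate (banked context): per has no integer
sign-constant depth-Δ₁ poly-wire circuits; `perHardLog3CF_iff_split2 : PerHardLog3CF ↔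
SuccinctPerHardLog3 ∧ UniformityLiftLog3`; attack lines of its own: τ-methods / succinct hitting
sets for univariates (Jansen–Santhanam 2012 via ChatterjeeTengse2023-type transfer), BSS transfer.
[difficulty: open-problem] [KoiranPerifel2011, Koiran2004, ChatterjeeTengse2023]
#9 SuccinctCollapseLog3 (support) — this node's own residual (banked context): if VP_ℂ = VNP_ℂ then
per has (n+c)-succinct constant-free depth-Δ₁ poly-wire circuits; kernel:
`succinctCollapseLog3_iff_residual : SuccinctCollapseLog3 ↔ (SuccinctPerHardLog3 → VH)` and
`succinctCollapseLog3_iff_walls' : SuccinctCollapseLog3 ↔ UniformityLiftLog3 ∧ ConstantLiftLog3 ∧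
CollapseLog3`. [difficulty: open-problem] [Burgisser2000, ChenKabanets2012]

TWO-LAYER PLAN. Foreseen glued splits (nothing filed now; skeletons in the lens folder bc/): A ⇐ S1
→ S2 → A with S1 = `SuccinctRungSubexp` (extend
ChenKabanets2012 Thm 1.3 to advice 2^√m at depth Δ₁ — inside the printed method by our reading, size
L) and S2 = budget amplification
2^√(log n) ↦ n (the step across the method frontier); U ⇐ (A → hardness against budget 2^n) →
(budget 2^n ≡ no constraint, by lookup-table
circuits for the pruned code word, provable now) → U; K ⇐ (constant-free-hard → hard against
ALGEBRAIC constants, the real content) →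
(algebraic-hard → hard over ℂ, generic specialisation / Nullstellensatz, provable in principle) → K;
B: lens-4's rungs T1/T2 (depth
⌊log₂⌊log₂ n⌋⌋+1 first).

KILL CRITERIA. Refuting A (a √N-succinct constant-free depth-logloglog poly family for per) refutes
VH itself — route and summit die together, so A is
never the kill switch. A PROOF that A is already a theorem of the Chen–Kabanets–Kinne trade-off
(acq-07423 / acq-14740) does not kill the
route: it retires A as PRINT-THEOREM and leaves the AND-node U ∧ K ∧ B (re-open one notch up: budget
n², aside pre-typed in the lens file
as `SuccinctPerHardLog3Sq`). Refuting U or K requires exhibiting constant-free (resp.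
constant-using) depth-Δ₁ poly circuits for per,
i.e. ¬PerHardLog3CF / ¬PerHardLog3 — each refutes VH. A proof of U ∧ K (both lifts) makes A ⟺
PerHardLog3 and this route merges into
route-ValiantsHypothesis-DepthWindow (`close --reason superseded --by`). Proved elsewhere that moots
it: VH, or per ∈ VP.

NOT DECOMPOSED YET. The Boolean translation of A (ChenKabanets2012 Lemma 2.2: threshold depth O(Δ₁),
the 0/1-permanent language `permanent01Graph`,
`UniformDepthSizeClass (SIZE u') tcBasis`), the exact advice book-keeping between "(n+c)-gate
bit-circuit for the KI code word" and
"α-weakly uniform" (α(m) ≈ 2^(m/2c)·m), the small-n slack (why `+ c` and `∃ w` are in the statement: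
at budget exactly n and n ≤ 3 no
circuit exists, which would make existence false for trivial reasons), the algebraic-constants
intermediate of K, and everything about B
(lens-4's T1/T2). `BinarisationBound` (complexity ≤ 2·edgeSize + 2), the one library lemma necessity
needs, is a theorem in tree since
lens-4 g2 (`Theorems/DepthWindowBinarisation.lean`); the lens file derives the unconditional
`summit_iff_split4'` from it.

CHEAPEST FALSIFIER. For A's NOVELTY (not truth): read the main theorem of Chen–Kabanets–Kinne,
Algorithmica 2013 (doi:10.1007/s00453-013-9823-y, acq-07423) and
Kinne2012 (doi:10.1007/978-3-642-32241-9_36, acq-14740): if the stated trade-off gives PER ∉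
2^(εm)-weakly-uniform poly-size threshold depth
o(log log n), A is a PRINT-THEOREM and the node shifts to budget n² / the three walls. Ran:
ChenKabanets2012 ECCC TR12-007 full text
(paper:url-5a44f5729fba) pp. 3, 7–13, 16 — Thm 1.3 states poly(m) advice only; Lemma 3.4 needs γ ≤
2^o(m); our parameter chase (NOTES)
closes for 2^(m^δ), δ < 1, and breaks for 2^(εm); Kinne2012 abstract: regimes (O(1), n^o(1)),
(o(loglog), polylog) only. For U/K: none cheap
(both are open implications whose failure refutes VH).

NUMBERS. Δ₁(n) = ⌊log₂⌊log₂⌊log₂ n⌋⌋⌋ + 1 (lens-4's window depth; nonuniform reach κ·logloglog n, κ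
∈ [0.36, 0.72], BhargavDuttaSaxena2024 Thm 1.1/1.7,
LimayeSrinivasanTavenas2025 Cor. 4, in tree for constant depth as
`Literature.Computability.Complexity.lst_constantDepth_imm_lower_bound_holds`).
Succinctness axis at depth o(log log n), poly size, constant-free: PRINT-THEOREM up to
poly(m)-weakly-uniform = polylog(n)-succinct
(ChenKabanets2012 Thm 1.3 = Thm 4.10, Table 1 [corpus:paper:url-5a44f5729fba p.3, p.13];
KoiranPerifel2009 Cor. 7 [corpus:paper:arxiv-0902.1866 p.7]);
at constant depth up to 2^o(m) = n^o(1)-succinct (ChenKabanets2012 Thm 1.1/4.3; JansenSanthanam2013;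
Kinne2012 regime 3) and, non-uniformly in
characteristic 0, everything (LST). Method frontier at depth Δ₁ by our reading of Lemmas 2.4 (3d+2
alternations), 3.1 (advice o(n), time
n/log² n), 3.3, 3.4 (blow-up (s∘q)^(d+1) = n^polyloglog): advice 2^(m^(1−ε)) inside, 2^(εm) outside
[corpus:paper:url-5a44f5729fba p.7–11].
A's budget: n + c gates = 2^(Θ(m/c))·m advice bits for size-n^c circuits (m = Θ(c log n)).

DEFINITION REQUESTS. None load-bearing: every item is stated over in-tree `ArithCircuit` (ℤ and ℂ),
`HasSignConstants`, `map`, `rename`, `finProdFinEquiv`,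
`encodeArithCircuit` (ValiantBooleanBridge, Kabanets–Impagliazzo code, injective),
`Literature.Computability.Complexity.Circuit`, `IsOver B2`,
`size`, `Computes`, `productDepth`, `edgeSize`, `perPoly`, `VP`, `VNP`. Wanted later (not items):
invariance of `productDepth`/`edgeSize` under `map`/`rename` (cosmetic: the items measure the
complexified circuit).

Novelty: Searches (2026-08-29): lit search "Koiran Perifel interpolation Valiant" (6 local: KoiranPerifel2011
held as paper:arxiv-0710.0360); lit search
"hardness magnification locality" (6 local: CHOPRS2020 paper:arxiv-1911.08297, Pich 2212.09285, …);
lit galaxy search "hardness magnification"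
--star all (15 rows; [galaxy:pdf:9148114949920353960] Atserias–Müller 2025 simple general
magnification); lit galaxy search "weakly uniform|
weakly-uniform" --star pdf (8 rows, 0 relevant); earlier this session: lit search / galaxy for
"succinct arithmetic circuits permanent",
"weakly uniform threshold permanent" (CK12 ECCC TR12-007 held paper:url-5a44f5729fba; KP09
paper:arxiv-0902.1866; GKSS22 1905.00091; KST23
toc v019a012), WebFetch of the Kinne2012 Springer abstract; lit want acq-14738 (JS11 I&C), acq-14740
(Kinne2012), acq-07423 (CKK13); rg in
tree: ValiantBooleanBridge (encodeArithCircuit), UniformCircuitClasses (DC-uniformity, KP09 §2.4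
cited), CT23* barrier files, no Theses file
mentions succinct/uniform; ledger negatives ValiantsHypothesis (32; none on uniformity/constants).
Nearest prior art found: ChenKabanets2012 Thm 1.3 / KoiranPerifel2009 Cor. 7 (the printed rung below
A); JansenSanthanam2013 (succinct constant
depth); route-ValiantsHypothesis-DepthWindow (the hub PerHardLog3 and the shared residual
CollapseLog3); census v2 row H8 (uniformity marked
strictly-weaker/attackable, untyped).
Delta: the first TYPED succinctness dial for per inside the open depth window, placed one notc  [refs: paper:arxiv-0710.0360, paper:arxiv-1911.08297, paper:url-5a44f5729fba, paper:arxiv-0902.1866, KoiranPerifel2011, CHOPRS2020, Kinne2012, ChenKabanets2012, KoiranPerifel2009, JansenSanthanam2013]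

Barriers (technique_class: indirect-diagonalisation, uniformity-lift, constant-elim): - technique_class: indirect-diagonalisation, uniformity-lift, constant-elim
- Literature.Barriers.ValiantsHypothesis.AlgebraicNaturalProofs: A is to be closed by (indirect)
diagonalisation against succinctly described circuits (Allender1999 / KoiranPerifel2009 /
ChenKabanets2012), which produces no polynomial-size equation vanishing on VP — outside the FSV/GKSS
natural class by construction (and the barrier is conditional on succinct hitting-set generators
anyway); U and K are implications, not lower-bound proofs, so the barrier does not quantify over
them. Uncatalogued-for-the-gate files consulted and found ORTHOGONAL (they all presuppose succinct
HITTING SETS, which nothing here assumes; our "succinct" is the description size of the circuit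
computing per): the CT23 files (lower bounds from succinct hitting sets; succinct hitting sets
versus VPSPACE — nearest in-tree use of Koiran–Perifel uniformity vocabulary), the
succinct-hitting-sets degree transfer, the small definable hitting sets file, and the KI-generator
variant of this barrier (the Kabanets–Impagliazzo code `encodeArithCircuit` is used here only as the
DESCRIPTION of a circuit, not as a generator; no PIT derandomisation is assumed). The uncatalogued
LOCALITY barrier (CHOPRS2020) is the honest threat to the generic form of U (magnification whose
kernel lower bound localises): it does bite that generic form; the bet is that U is per-specific
(VNP-complete, self-reducible, integer) at fixed small product-depth, status

History (route lifecycle, newest last):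
- 2026-08-29T22:27:36Z · rev 8: informal re-worded for PerHardSomePrimeLog3 (planner-decomp-val-lens-2-g6-0)
- 2026-08-29T22:27:53Z · rev 9: informal re-worded for PerHardCofiniteCharLog3 (planner-decomp-val-lens-2-g6-0)
- 2026-08-29T23:55:25Z · rev 11: informal re-worded for UniformityLiftLog3 (planner-decomp-val-lens-2-g7-0)
- 2026-08-29T23:55:35Z · rev 12: informal re-worded for SuccinctPerHardLog3 (planner-decomp-val-lens-2-g7-0)
- 2026-08-29T23:55:49Z · rev 13: informal re-worded for PerHardLog3CF (planner-decomp-val-lens-2-g7-0)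
- 2026-08-30T00:55:47Z · rev 15: informal re-worded for SuccinctPerHardLog3 (planner-decomp-val-lens-2-g8-0)

sub-problem: ValiantsHypothesis · status: draft · opened planner-decomp-val-lens-2-g2-0 2026-08-29T19:14:22Z · rev 19 · ledger route-ValiantsHypothesis-SuccinctLift
GENERATED by the gate from the ledger (D-0016/17). Provers cite these decls: `theorem foo : Summit.ValiantsHypothesis.ValiantsHypothesis.Theses.SuccinctLift.<Decl> := …` in Summits/ValiantsHypothesis/ValiantsHypothesis/Theorems/<Name>.lean.
-/

namespace Summit.ValiantsHypothesis.ValiantsHypothesis.Theses.SuccinctLift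

open scoped BigOperators Topology Manifold Classical MeasureTheory ProbabilityTheory Matrix InnerProductSpace ComplexConjugate ContinuousMap
open Filter Set Function TopologicalSpace MeasureTheory

attribute [summit_statement] _root_.ValiantsHypothesis

open Literature.PNP

/-- item stmt-ValiantsHypothesis-23779 · crux · rank 1 · closed · proved by Summit.ValiantsHypothesis.ValiantsHypothesis.Theorems.SuccinctLiftCharTwo.perHardSomePrimeLog3_proof (planner) · by planner
why it might fail: False iff ONE exponent c yields depth-Δ₁ poly-wire circuits for per_n over EVERY prime field at once; over a fixed 𝔽_p per is known hard only below slope 1/2 (Forbes 2024), and #_pP-completeness of per mod p gives no circuit lower bound.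
sources: Burgisser2000, KoiranPerifel2011, BurgisserClausenShokrollahi1997, Forbes2024LowDepth, LimayeSrinivasanTavenas2025
retired/moot children: BoolBridgeF2 [moot: ∀ (M : ℕ) (σ : Type) (e : Fin M ≃ σ) (C : Literature.Computability.AlgebraicComp]; MajorityPermanentMod2 [moot: ∀ k : ℕ, ∃ m : ℕ, m ≤ (k + 2) ^ 2 ∧ ∃ E : Fin m × Fin m → Bool ⊕ (Fin k × Bool),]; SmolenskyBeatsLog3 [moot: ∀ c : ℕ, ∃ k : ℕ, Odd k ∧ ∃ ℓ : ℕ, 1 ≤ ℓ ∧ ∀ m : ℕ, m ≤ (k + 2) ^ 2 → 64 * ((2 -]; PerHardSomePrimeLog3Glue [moot: BoolBridgeF2 → MajorityPermanentMod2 → SmolenskyBeatsLog3 → PerHardSomePrimeLog3]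
[aside] ROAD P (critic w7, gen 5; gen 6 update) = `¬ PerEasyEveryPrime Δ₁` of
Theorems/SuccinctLiftFiniteFields.lean (p746038): for every exponent c some per_n has NO
product-depth-Δ₁, (n^c+c)-wire arithmetic circuit over SOME prime field 𝔽_p = ZMod p (constants are
field elements: no constant wall; uniformity irrelevant). NECESSARY FOR VH — KERNEL since gen 6:
`perHardSomePrimeLog3_of_vh : VH → P` (Theorems/SuccinctLiftLefschetz.lean, p748078, commit
ce16de410abe), through the Lefschetz transfer T = `exists_complexCircuit_of_charSpread` (circuits
for an integer polynomial over fields of unboundedly many characteristics at product depth Δ and s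
wires ⟹ a ℂ-circuit at depth Δ with s wires: BCS 1997 §4.1/§9.1 generic skeletons
`Bookkeeping.finite_skeletons_of_fanIn_le` + pigeonhole + `exists_ringHom_complex_of_charSpread`,
Theorems/SuccinctLiftGenericSkeletons.lean p747921); also `perHardSomePrimeLog3_of_perHardLog3 :
PerHardLog3 → P`. KERNEL (p746038): P ⟹ HeightLiftLog3 (stub `heightLiftLog3_of_perHardSomePrime` on
item 23720, proved), P ⟹ ¬PerEasyIntAdv Δ₁ (the hypothesis of AlgDescentLog3), P ⟹ PerHardLog3CF. So
P is a NECESSARY WAYPOINT strictly inside the spine: VH ⟹ P ⟹ (H ∧ h -/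
@[route_item "route-ValiantsHypothesis-SuccinctLift", crux]
def PerHardSomePrimeLog3 : Prop :=
  ¬ ∃ c : ℕ, ∀ n p : ℕ, p.Prime → ∃ C : Literature.Computability.AlgebraicComplexity.ArithCircuit (ZMod p) (Fin n × Fin n), C.Computes (Literature.Computability.AlgebraicComplexity.perPoly (Fin n) (ZMod p)) ∧ C.productDepth ≤ Nat.log 2 (Nat.log 2 (Nat.log 2 n)) + 1 ∧ C.edgeSize ≤ n ^ c + c

-- `PerHardSomePrimeLog3` holds: proved by `Summit.ValiantsHypothesis.ValiantsHypothesis.Theorems.SuccinctLiftCharTwo.perHardSomePrimeLog3_proof` (its module imports this route file, so no `_holds` link can be stated here).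

/-- item stmt-ValiantsHypothesis-23651 · crux · rank 2 · closed · proved by Summit.ValiantsHypothesis.ValiantsHypothesis.Theorems.SuccinctLiftCharTwo.succinctPerHardLog3_proof (planner) · by planner
why it might fail: False iff per HAS √N-succinct constant-free depth-logloglog poly circuits (then VH fails too); the risk is vacuity of novelty: a CK12/Kinne-type trade-off may already prove it (then A is a theorem and the node is U ∧ K ∧ B).
sources: ChenKabanets2012, JansenSanthanam2013, KoiranPerifel2009, Kinne2012, Allender1999
[crux] A (ATTACKABLE leaf, WEAKER — kernel `succinctPerHardLog3_of_vh`; UNDECIDED-with-test: does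
the Chen–Kabanets–Kinne trade-off (acq-07423) or Kinne2012 (acq-14740) already cover advice 2^(εm)
at depth log log log n? our reading of ChenKabanets2012 §3–4, Lemma 3.4 p.10, says no): for no c is
there, for every n, a sign-constant integer circuit on n² variables whose complexification computes
per_n within product-depth ⌊log₂⌊log₂⌊log₂ n⌋⌋⌋+1 and n^c + c wires AND whose code word
`encodeArithCircuit (n·n) C` is (n+c)-succinct (a B₂-circuit with ≤ n+c gates maps a w-bit address,
|code| ≤ 2^w, to that bit). GEN 7 (description dial): A = notch β = n+c, strictly between the kernel
TOP β = n^c+c ⟺ PerHardLog3CF (`perEasyCF_iff_polySuccinct`; U = the budget gap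
`uniformityLiftLog3_iff_budgetGap`) and the print-method FLOOR (aside 23476). GEN 8 (natural column,
Theorems/SuccinctLiftNaturalColumn.lean p753321): A ⟺ "∀ c ∃ n ∃ D: D an FSV natural proof (tree
`IsNaturalProof`, degree ≤ |SuccinctClass|, a FINITE class, kernel bound (L+1)·2^L, L =
8(n²+n^c+c+27)²) with D(PER_n) ≠ 0" (`succinctPerHardLog3_iff_natSep`) — the FSV/GKSS barrier is
void for finite classes; TYPING NOTE: A's witnesses -/
@[route_item "route-ValiantsHypothesis-SuccinctLift", crux]
def SuccinctPerHardLog3 : Prop :=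
  ¬ ∃ c : ℕ, ∀ n : ℕ, ∃ C : Literature.Computability.AlgebraicComplexity.ArithCircuit ℤ (Fin (n * n)), ∃ C' : Literature.Computability.AlgebraicComplexity.ArithCircuit ℂ (Fin n × Fin n), C' = (C.map (Int.castRingHom ℂ)).rename ⇑(finProdFinEquiv (m := n) (n := n)).symm ∧ C.HasSignConstants ∧ C'.Computes (Literature.Computability.AlgebraicComplexity.perPoly (Fin n) ℂ) ∧ C'.productDepth ≤ Nat.log 2 (Nat.log 2 (Nat.log 2 n)) + 1 ∧ C'.edgeSize ≤ n ^ c + c ∧ ∃ w : ℕ, (Literature.Computability.AlgebraicComplexity.encodeArithCircuit (n * n) C).length ≤ 2 ^ w ∧ ∃ D : Literature.Computability.Complexity.Circuit (Fin w), D.IsOver Literature.Computability.Complexity.B2 ∧ D.size ≤ n + c ∧ D.Computes fun a => (Literature.Computability.AlgebraicComplexity.encodeArithCircuit (n * n) C).getD (∑ t : Fin w, if a t then 2 ^ (t : ℕ) else 0) false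

-- `SuccinctPerHardLog3` holds: proved by `Summit.ValiantsHypothesis.ValiantsHypothesis.Theorems.SuccinctLiftCharTwo.succinctPerHardLog3_proof` (its module imports this route file, so no `_holds` link can be stated here).

/-- item stmt-ValiantsHypothesis-23652 · crux · rank 3 · closed · proved by Summit.ValiantsHypothesis.ValiantsHypothesis.Theorems.SuccinctLiftCharTwo.uniformityLiftLog3_proof (planner) · by planner
why it might fail: No uniform→non-uniform lifting theorem is known for any explicit polynomial; the locality barrier (CHOPRS2020) kills the generic magnification route; fails iff per has CF depth-Δ₁ poly circuits but only incompressible ones.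
sources: CHOPRS2020, McKayMurrayWilliams2019, ChenKabanets2012, ChatterjeeTengse2023
[crux] U (declared-RESIDUAL factor 1, IDEA-NEEDED / BARRIER leaf, WEAKER — kernel
`uniformityLiftLog3_of_vh`, since VH gives its conclusion): if per has no (n+c)-succinct
constant-free depth-Δ₁ poly-wire circuits then it has no constant-free depth-Δ₁ poly-wire circuits
at all; `perHardLog3CF_iff_split2 : PerHardLog3CF ↔ A ∧ U` (kernel). GEN 7 (KERNEL, registered stub
`uniformityLiftLog3_iff_budgetGap` on this item, proved in Theorems/SuccinctLiftDescriptionDial.lean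
p751223): U IS EXACTLY A BUDGET GAP ON ONE TYPED DIAL — `UniformityLiftLog3 ↔ (SuccinctPerHardLog3 →
PerHardDesc (n^c+c) Δ₁)` where `PerHardDesc β Δ := ¬ PerEasySuccinctCF β Δ` (description budget β n
c for the B₂-circuit reading the code word; Theorems/SuccinctLiftCircuitCodes.lean p750834), because
at POLYNOMIAL budget succinctness is FREE for every depth function (`perEasyCF_iff_polySuccinct`:
constant-free normal form + code length ≤ 8(N+e+27)² + table circuits ≤ 5·2^w gates), i.e. the
conclusion PerHardLog3CF is the TOP notch n^c+c of the dial whose notch n+c is A. Reading: a lower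
bound for PER against circuits whose 2^m-bit code words (m = Θ(c'·log n)) have B₂-descriptions of
size n+c ≈ 2^{m/2c'} must LIFT to des -/
@[route_item "route-ValiantsHypothesis-SuccinctLift", crux]
def UniformityLiftLog3 : Prop :=
  (¬ ∃ c : ℕ, ∀ n : ℕ, ∃ C : Literature.Computability.AlgebraicComplexity.ArithCircuit ℤ (Fin (n * n)), ∃ C' : Literature.Computability.AlgebraicComplexity.ArithCircuit ℂ (Fin n × Fin n), C' = (C.map (Int.castRingHom ℂ)).rename ⇑(finProdFinEquiv (m := n) (n := n)).symm ∧ C.HasSignConstants ∧ C'.Computes (Literature.Computability.AlgebraicComplexity.perPoly (Fin n) ℂ) ∧ C'.productDepth ≤ Nat.log 2 (Nat.log 2 (Nat.log 2 n)) + 1 ∧ C'.edgeSize ≤ n ^ c + c ∧ ∃ w : ℕ, (Literature.Computability.AlgebraicComplexity.encodeArithCircuit (n * n) C).length ≤ 2 ^ w ∧ ∃ D : Literature.Computability.Complexity.Circuit (Fin w), D.IsOver Literature.Computability.Complexity.B2 ∧ D.size ≤ n + c ∧ D.Computes fun a => (Literature.Computability.AlgebraicComplexity.encodeArithCircuit (n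 * n) C).getD (∑ t : Fin w, if a t then 2 ^ (t : ℕ) else 0) false) → ¬ ∃ c : ℕ, ∀ n : ℕ, ∃ C : Literature.Computability.AlgebraicComplexity.ArithCircuit ℤ (Fin (n * n)), ∃ C' : Literature.Computability.AlgebraicComplexity.ArithCircuit ℂ (Fin n × Fin n), C' = (C.map (Int.castRingHom ℂ)).rename ⇑(finProdFinEquiv (m := n) (n := n)).symm ∧ C.HasSignConstants ∧ C'.Computes (Literature.Computability.AlgebraicComplexity.perPoly (Fin n) ℂ) ∧ C'.productDepth ≤ Nat.log 2 (Nat.log 2 (Nat.log 2 n)) + 1 ∧ C'.edgeSize ≤ n ^ c + c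

-- `UniformityLiftLog3` holds: proved by `Summit.ValiantsHypothesis.ValiantsHypothesis.Theorems.SuccinctLiftCharTwo.uniformityLiftLog3_proof` (its module imports this route file, so no `_holds` link can be stated here).

/-- item stmt-ValiantsHypothesis-23684 · crux · rank 4 · SPLIT (gen 1) into HeightLiftLog3, AlgDescentLog3 + glue Summit.ValiantsHypothesis.ValiantsHypothesis.Theorems.SuccinctLift.algConstantLiftLog3_of_lifts · direct attempts still welcome (low priority) · by planner
why it might fail: Fails iff algebraic constants of degree/height exponential in n shorten per at product-depth logloglog n; no depth-preserving removal of high-degree algebraic constants is known (Burgisser2000 Ch.4 only reaches Boolean mod-p under GRH; Koiran2004; KP11 Thm 9).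
sources: Burgisser2000, Koiran2004, KoiranPerifel2011, Burgisser2009
[crux] K_alg (declared-RESIDUAL factor 2′, IDEA-NEEDED leaf, WEAKER — kernel
`algConstantLiftLog3_of_vh`; replaces K = `ConstantLiftLog3` as the load-bearing binder of `closes`,
K ↔ K_alg being the tree theorem `Theorems.SuccinctLift.constantLiftLog3_iff_alg` (p741265): the
transcendental half of constant elimination — a ℂ-circuit for a rational polynomial can be given
constants in algebraicClosure ℚ ℂ at the identical skeleton, `exists_algebraicConstants` — is
PROVED): if per has no constant-free (sign-constant integer) depth-Δ₁ poly-wire circuits then it has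
no depth-Δ₁ poly-wire circuits with ALGEBRAIC constants (circuits over algebraicClosure ℚ ℂ
computing per there). What remains is algebraic-constant elimination at FIXED product depth
(coefficient dial: Q̄ → bounded-degree number field is the real wall; fixed number field → ℚ is
interpolation at the same depth with s^O(Δ) blow-up; ℚ → ℤ-multiple only).
`perHardLog3_iff_split3_alg : PerHardLog3 ↔ A ∧ U ∧ K_alg` (kernel). [difficulty: open-problem] -/
@[route_item "route-ValiantsHypothesis-SuccinctLift", crux]
def AlgConstantLiftLog3 : Prop :=
  (¬ ∃ c : ℕ, ∀ n : ℕ, ∃ C : Literature.Computability.AlgebraicComplexity.ArithCircuit ℤ (Fin (n * n)), ∃ C' : Literature.Computability.AlgebraicComplexity.ArithCircuit ℂ (Fin n × Fin n), C' = (C.map (Int.castRingHom ℂ)).rename ⇑(finProdFinEquiv (m := n) (n := n)).symm ∧ C.HasSignConstants ∧ C'.Computes (Literature.Computability.AlgebraicComplexity.perPoly (Fin n) ℂ) ∧ C'.productDepth ≤ Nat.log 2 (Nat.log 2 (Nat.log 2 n)) + 1 ∧ C'.edgeSize ≤ n ^ c + c) → ¬ ∃ c : ℕ, ∀ n : ℕ,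 ∃ C : Literature.Computability.AlgebraicComplexity.ArithCircuit ↥(algebraicClosure ℚ ℂ) (Fin n × Fin n), C.Computes (Literature.Computability.AlgebraicComplexity.perPoly (Fin n) ↥(algebraicClosure ℚ ℂ)) ∧ C.productDepth ≤ Nat.log 2 (Nat.log 2 (Nat.log 2 n)) + 1 ∧ C.edgeSize ≤ n ^ c + c

-- parent: AlgConstantLiftLog3 · child (gen 1)
/--     item stmt-ValiantsHypothesis-23720 · crux · rank 401 · closed · proved by Summit.ValiantsHypothesis.ValiantsHypothesis.Theorems.SuccinctLiftCharTwo.heightLiftLog3_proof (planner)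
    parent: AlgConstantLiftLog3 · by planner
    why it might fail: Fails iff integer advice of super-polynomial bit length shortens per at product depth Δ₁: one huge integer can store per_n's value table and nothing shows it cannot be decoded exactly at fixed depth (known reductions of large constants are modular, GRH-conditional, Boolean: Bürgisser 2000 §4.3).
    sources: KoiranPerifel2011, Burgisser2000, Burgisser2009, Koiran2004
[crux] WALL-H = the HEIGHT lift of the coefficient dial in Koiran–Perifel ADVICE form
(declared-RESIDUAL, IDEA-NEEDED leaf, WEAKER — consequence of the parent K_alg by dial monotonicity,
kernel `Theorems.SuccinctLift.heightLiftAt_of_algConstantLiftAt`; child 1 of the exact split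
`algConstantLiftLog3_iff_lifts : AlgConstantLiftLog3 ↔ HeightLiftLog3 ∧ AlgDescentLog3`,
Theorems/SuccinctLiftIntegerAdvice.lean): if per_n has no depth-Δ₁ (= ⌊log₂⌊log₂⌊log₂ n⌋⌋⌋+1),
(n^c+c)-wire SIGN-constant integer circuits with m ≤ n^c+c INTEGER ADVICE leaves of POLYNOMIAL bit
length (|a_i| ≤ 2^(n^c+c)), then it has none with integer advice of ARBITRARY height. The rung below
it — integer advice of polynomial bit length is FREE at the same product depth (binary numerals by
sum gates, `intAdviceLiftLog3`) — is PROVED, so this item isolates exactly the height question the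
critic named (w4). -/
@[route_item "route-ValiantsHypothesis-SuccinctLift", crux]
def HeightLiftLog3 : Prop :=
  (¬ ∃ c : ℕ, ∀ n : ℕ, ∃ m : ℕ, m ≤ n ^ c + c ∧ ∃ a : Fin m → ℤ, (∀ i, (a i).natAbs ≤ 2 ^ (n ^ c + c)) ∧ ∃ C : Literature.Computability.AlgebraicComplexity.ArithCircuit ℤ (Fin (n * n) ⊕ Fin m), C.HasSignConstants ∧ ∃ C' : Literature.Computability.AlgebraicComplexity.ArithCircuit ℂ (Fin n × Fin n), C' = ((C.substVC (Sum.elim Sum.inl fun i => Sum.inr (a i))).map (Int.castRingHom ℂ)).rename ⇑(finProdFinEquiv (m := n) (n := n)).symm ∧ C'.Computes (Literature.Computability.AlgebraicComplexity.perPoly (Fin n) ℂ) ∧ C'.productDepth ≤ Nat.log 2 (Nat.log 2 (Nat.log 2 n)) + 1 ∧ C'.edgeSize ≤ n ^ c + c) → ¬ ∃ c : ℕ, ∀ n : ℕ, ∃ m : ℕ, m ≤ n ^ c + c ∧ ∃ a : Fin m → ℤ, ∃ C : Literature.Computability.AlgebraicComplexity.ArithCircuit ℤ (Fin (n * n) ⊕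 Fin m), C.HasSignConstants ∧ ∃ C' : Literature.Computability.AlgebraicComplexity.ArithCircuit ℂ (Fin n × Fin n), C' = ((C.substVC (Sum.elim Sum.inl fun i => Sum.inr (a i))).map (Int.castRingHom ℂ)).rename ⇑(finProdFinEquiv (m := n) (n := n)).symm ∧ C'.Computes (Literature.Computability.AlgebraicComplexity.perPoly (Fin n) ℂ) ∧ C'.productDepth ≤ Nat.log 2 (Nat.log 2 (Nat.log 2 n)) + 1 ∧ C'.edgeSize ≤ n ^ c + c

-- `HeightLiftLog3` holds: proved by `Summit.ValiantsHypothesis.ValiantsHypothesis.Theorems.SuccinctLiftCharTwo.heightLiftLog3_proof` (its module imports this route file, so no `_holds` link can be stated here).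

-- parent: AlgConstantLiftLog3 · child (gen 1)
/--     item stmt-ValiantsHypothesis-23721 · crux · rank 402 · open
    parent: AlgConstantLiftLog3 · by planner
    why it might fail: Fails iff algebraic constants of degree, denominators or sum-gate scalars growing with n shorten per at product depth Δ₁ beyond integer advice; every known elimination (Bürgisser 2000 Thm 4.13, fixed number field, integral multiple N·f, size not depth) changes the depth or the polynomial.
    sources: Burgisser2000, Koiran2004, KoiranPerifel2011, Burgisser2009
[crux] WALL-D = the ALGEBRAIC-DESCENT lift of the coefficient dial in advice form
(declared-RESIDUAL, IDEA-NEEDED leaf, WEAKER — kernel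
`Theorems.SuccinctLift.algDescentAt_of_algConstantLiftAt`; child 2 of the exact split of K_alg): if
per_n has no depth-Δ₁, (n^c+c)-wire sign circuits with m ≤ n^c+c integer advice leaves (ANY height),
then it has no depth-Δ₁, (n^c+c)-wire circuits with constants (leaves AND sum-gate scalars) in
algebraicClosure ℚ ℂ. Contains the degree descent Q̄ → number field of bounded degree (g3 S1, the
wall proper), the interpolation step fixed number field → ℚ (g3 S2) and the denominator/scalar
normalisation ℚ-constants → integer advice (clearing denominators multiplies per by N^(formal
degree); removing N and emulating sum-gate scalars by advice leaves both want a product layer) — all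
at the SAME product depth Δ₁. Known descent (Bürgisser 2000 Thm 4.13 / BCS Prop 4.16) is size-level,
from a FIXED number field, to an integral MULTIPLE only (tree, τ-level:
Theorems/AnyonJetsJetConstantElimIntegralMultipleNumberField.lean). -/
@[route_item "route-ValiantsHypothesis-SuccinctLift", crux]
def AlgDescentLog3 : Prop :=
  (¬ ∃ c : ℕ, ∀ n : ℕ, ∃ m : ℕ, m ≤ n ^ c + c ∧ ∃ a : Fin m → ℤ, ∃ C : Literature.Computability.AlgebraicComplexity.ArithCircuit ℤ (Fin (n * n) ⊕ Fin m), C.HasSignConstants ∧ ∃ C' : Literature.Computability.AlgebraicComplexity.ArithCircuit ℂ (Fin n × Fin n), C' = ((C.substVC (Sum.elim Sum.inl fun i => Sum.inr (a i))).map (Int.castRingHom ℂ)).rename ⇑(finProdFinEquiv (m := n) (n := n)).symm ∧ C'.Computes (Literature.Computability.AlgebraicComplexity.perPoly (Fin n) ℂ) ∧ C'.productDepth ≤ Nat.log 2 (Nat.log 2 (Nat.log 2 n)) + 1 ∧ C'.edgeSize ≤ n ^ c + c) → ¬ ∃ c : ℕ, ∀ n : ℕ, ∃ C : Literature.Computability.AlgebraicComplexity.ArithCircuit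 ↥(algebraicClosure ℚ ℂ) (Fin n × Fin n), C.Computes (Literature.Computability.AlgebraicComplexity.perPoly (Fin n) ↥(algebraicClosure ℚ ℂ)) ∧ C.productDepth ≤ Nat.log 2 (Nat.log 2 (Nat.log 2 n)) + 1 ∧ C.edgeSize ≤ n ^ c + c

/-- glue for the split of `AlgConstantLiftLog3`: landed theorem `Summit.ValiantsHypothesis.ValiantsHypothesis.Theorems.SuccinctLift.algConstantLiftLog3_of_lifts`. -/
theorem AlgConstantLiftLog3GlueBy_holds : HeightLiftLog3 → AlgDescentLog3 → AlgConstantLiftLog3 := _root_.Summit.ValiantsHypothesis.ValiantsHypothesis.Theorems.SuccinctLift.algConstantLiftLog3_of_lifts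

/-- item stmt-ValiantsHypothesis-23550 · crux · rank 5 · open · by planner
why it might fail: Depth reduction below Θ(log d) costs n^Θ(d^(1/Δ)) unconditionally and nobody has used VP=VNP to shorten product-depth for the complete family; false iff VP=VNP yet per (equivalently IMM) is hard at depth Δ₁.
sources: ValiantSkyumBerkowitzRackoff1983, Tavenas2015, Burgisser2000, LimayeSrinivasanTavenas2025
[crux] B (declared RESIDUAL, IDEA-NEEDED leaf, WEAKER/UNDECIDED-with-test): if VP_ℂ = VNP_ℂ then for
some c every per_n has an unbounded-fan-in circuit of product-depth ≤ ⌊log₂⌊log₂⌊log₂ n⌋⌋⌋ + 1 with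
at most n^c + c wires — the collapse propagates from VSBR depth ⌈log₂ n⌉ down to depth log log log n
for the complete family. Necessary for VH (kernel, vacuous: `collapseLog3_of_vh`); exactly the
declared residual of PerHardLog3 (`collapseLog3_iff_residual : CollapseLog3 ↔ (PerHardLog3 → VH)`,
kernel); strictly weaker: with ¬VH it only yields poly-wire depth-Δ₁ circuits for per, contradicting
no theorem. [difficulty: open-problem] -/
@[route_item "route-ValiantsHypothesis-SuccinctLift", crux]
def CollapseLog3 : Prop :=
  Literature.Computability.AlgebraicComplexity.VP ℂ = Literature.Computability.AlgebraicComplexity.VNP ℂ → ∃ c : ℕ, ∀ n : ℕ, ∃ C : Literature.Computability.AlgebraicComplexity.ArithCircuit ℂ (Fin n × Fin n), C.Computes (Literature.Computability.AlgebraicComplexity.perPoly (Fin n) ℂ) ∧ C.productDepth ≤ Nat.log 2 (Nat.log 2 (Nat.log 2 n)) + 1 ∧ C.edgeSize ≤ n ^ c + c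

/-- item stmt-ValiantsHypothesis-23476 · aside · rank 1 · closed · proved by Summit.ValiantsHypothesis.ValiantsHypothesis.Theorems.SuccinctLiftCharTwo.succinctRungPolylogLog3_proof (planner) · by planner
why it might fail: PRINT-METHOD port, not a quoted theorem: CK12 Thm 4.10 is for direct-connection succinctness and total depth; positional code bits + product depth need an indexing/sum-flattening lemma — a gap there leaves the floor unproved (refutation = polylog-succinct poly-wire CF circuits for PER, contra CK12).
sources: ChenKabanets2012, JansenSanthanam2011, KoiranPerifel2009, HesseAllenderBarrington2002, AroraBarakCC2009
[aside] FLOOR of the DESCRIPTION DIAL at Δ₁ (gen 7, critic w1's succinctness column) = lens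
`SuccinctRungPolylog` (Iff.rfl): for EVERY k, PER has no constant-free (sign-constant integer)
product-depth-Δ₁ (Δ₁ = ⌊log₂⌊log₂⌊log₂ n⌋⌋⌋+1) poly-wire circuits whose code word
`encodeArithCircuit (n·n) C` is ((log₂ n)^k + c)-succinct (a B₂-circuit with ≤ (log₂ n)^k + c gates
maps a w-bit address to that bit of the code). The description dial `PerHardDesc β Δ := ¬
Theorems.SuccinctLift.PerEasySuccinctCF β Δ` (Theorems/SuccinctLiftCircuitCodes.lean p750834,
Theorems/SuccinctLiftDescriptionDial.lean p751223) has: TOP β = n^c+c ⟺ PerHardLog3CF — KERNEL for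
every Δ (`perEasyCF_iff_polySuccinct`: at polynomial description budget succinctness is free —
constant-free normal form `exists_normalForm_signConst`, code length ≤ 8(N+e+27)²
`length_encodeArithCircuit_le_sq`, table circuits ≤ 5·2^w gates `exists_tableCircuit`); notch β =
n+c = A = SuccinctPerHardLog3; this floor below A — KERNEL order `A ⟹ floor` for all k
(`perEasySuccinctCF_linear_of_polylog` + `exists_log_pow_le_add` (log₂ n)^k ≤ n + K; lens
`succinctRungPolylogLog3_of_A`, `dial_chain_log3`), hence VH ⟹ floor. STATUS of the floor itself -/
@[route_item "route-ValiantsHypothesis-SuccinctLift"]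
def SuccinctRungPolylogLog3 : Prop :=
  (∀ k : ℕ, ¬ ∃ c : ℕ, ∀ n : ℕ, ∃ C : Literature.Computability.AlgebraicComplexity.ArithCircuit ℤ (Fin (n * n)), ∃ C' : Literature.Computability.AlgebraicComplexity.ArithCircuit ℂ (Fin n × Fin n), C' = (C.map (Int.castRingHom ℂ)).rename ⇑(finProdFinEquiv (m := n) (n := n)).symm ∧ C.HasSignConstants ∧ C'.Computes (Literature.Computability.AlgebraicComplexity.perPoly (Fin n) ℂ) ∧ C'.productDepth ≤ Nat.log 2 (Nat.log 2 (Nat.log 2 n)) + 1 ∧ C'.edgeSize ≤ n ^ c + c ∧ ∃ w : ℕ, (Literature.Computability.AlgebraicComplexity.encodeArithCircuit (n * n) C).length ≤ 2 ^ w ∧ ∃ D : Literature.Computability.Complexity.Circuit (Fin w), D.IsOver Literature.Computability.Complexity.B2 ∧ D.size ≤ Nat.log 2 n ^ k + c ∧ D.Computes fun a => (Literature.Computability.AlgebraicComplexity.encodeArithCircuit (n * n) C).getD (∑ t : Fin w, if a t then 2 ^ (t : ℕ) else 0) false)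

-- `SuccinctRungPolylogLog3` holds: proved by `Summit.ValiantsHypothesis.ValiantsHypothesis.Theorems.SuccinctLiftCharTwo.succinctRungPolylogLog3_proof` (its module imports this route file, so no `_holds` link can be stated here).

/-- item stmt-ValiantsHypothesis-23557 · aside · rank 1 · closed · proved by Summit.ValiantsHypothesis.ValiantsHypothesis.Theorems.SuccinctLiftCharTwo.pinnedPerHardLog3_proof (planner) · by planner
why it might fail: False iff PER has canonical-width (n+c)-succinct CF depth-Δ₁ poly circuits (then A and VH fail); novelty risk as A: a Chen–Kabanets–Kinne trade-off (acq-07423/14740) may already prove it; its product distinguisher has degree N^{O(1)} but is not known VP-constructible.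
sources: ChenKabanets2012, ForbesShpilkaVolk2018, ChatterjeeKumarRamyaSaptharishiTengse2020, GrochowKumarSaksSaraf2017, Wilson1985, JansenSanthanam2011
[aside] A′ = the WIDTH-PINNED notch of crux A (gen 8, lens-2 «NaturalColumn»): PER has no
constant-free (sign-constant integer) product-depth-Δ₁ (⌊log₂⌊log₂⌊log₂ n⌋⌋⌋+1) poly-wire circuits
whose Kabanets–Impagliazzo code word has length ≤ 2^{w₀} AND an (n+c)-gate B₂-description at the
CANONICAL address width w₀ = 1 + ⌊log₂(8(n²+n^c+c+27)²)⌋ (= tree `canonWidth n c` up to 1+k = k+1,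
lens `pinnedPerHardLog3_iff`; the width that addresses every NORMALISED witness:
`codeLen_lt_two_pow_canonWidth`, `exists_normalForm_signConst`). Kernel (lens §Gen 8 / tree
Theorems/SuccinctLiftNaturalColumn.lean p753321 + SuccinctLiftDescriptionCount.lean p753098): A ⟹ A′
(`perHardPinned_of_perHardSuccinct`), VH ⟹ A′, A ⟺ A′ ∧ PaddingLift (PaddingLift := A′ → A: heavy
padding by empty product gates — free in `edgeSize`, costly in code length — does not buy
description size; NOT claimed); A′ ⟺ an FSV algebraically natural proof against the finite class
PinnedClass of BUDGET-SENSITIVE degree ≤ (2^{w₀}+1)·descCount w₀ (n+c) ≤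
(2^{w₀}+1)(7(w₀+n+c+1))^{2(n+c)+2} nonzero at PER_n (`perHardPinned_iff_natSep`; log₂ degree = 26
419 vs log₂ N_n = 11 712 at (n,c)=(1024,1), i.e. degree ≤ N_n^{2.26}, exponent → 2), -/
@[route_item "route-ValiantsHypothesis-SuccinctLift"]
def PinnedPerHardLog3 : Prop :=
  ¬ ∃ c : ℕ, ∀ n : ℕ, ∃ C : Literature.Computability.AlgebraicComplexity.ArithCircuit ℤ (Fin (n * n)), ∃ C' : Literature.Computability.AlgebraicComplexity.ArithCircuit ℂ (Fin n × Fin n), C' = (C.map (Int.castRingHom ℂ)).rename ⇑(finProdFinEquiv (m := n) (n := n)).symm ∧ C.HasSignConstants ∧ C'.Computes (Literature.Computability.AlgebraicComplexity.perPoly (Fin n) ℂ) ∧ C'.productDepth ≤ Nat.log 2 (Nat.log 2 (Nat.log 2 n)) + 1 ∧ C'.edgeSize ≤ n ^ c + c ∧ (Literature.Computability.AlgebraicComplexity.encodeArithCircuit (n * n) C).length ≤ 2 ^ (1 + Nat.log 2 (8 * (n * n + (n ^ c + c) + 27) ^ 2)) ∧ ∃ D : Literature.Computability.Complexity.Circuit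 (Fin (1 + Nat.log 2 (8 * (n * n + (n ^ c + c) + 27) ^ 2))), D.IsOver Literature.Computability.Complexity.B2 ∧ D.size ≤ n + c ∧ D.Computes fun a => (Literature.Computability.AlgebraicComplexity.encodeArithCircuit (n * n) C).getD (∑ t : Fin (1 + Nat.log 2 (8 * (n * n + (n ^ c + c) + 27) ^ 2)), if a t then 2 ^ (t : ℕ) else 0) false

-- `PinnedPerHardLog3` holds: proved by `Summit.ValiantsHypothesis.ValiantsHypothesis.Theorems.SuccinctLiftCharTwo.pinnedPerHardLog3_proof` (its module imports this route file, so no `_holds` link can be stated here).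

/-- item stmt-ValiantsHypothesis-23864 · aside · rank 1 · closed · proved by Summit.ValiantsHypothesis.ValiantsHypothesis.Theorems.SuccinctLiftCharTwo.dCharLog3_proof (planner) · by planner
why it might fail: Fails iff for one exponent per_n has depth-Δ₁ poly-wire circuits over EVERY prime field ZMod p yet none with integer advice over ℂ; no fixed-depth CRT/lifting of circuits across characteristics is known, and per ≡ det (mod 2) shows small primes can be genuinely easier.
sources: Burgisser2000, KoiranPerifel2011, BurgisserClausenShokrollahi1997, Forbes2024LowDepth
[aside] D_char (gen 6) = `DChar Δ₁` of Theorems/SuccinctLiftLefschetz.lean (p748078): the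
POSITIVE-CHARACTERISTIC half of wall D = AlgDescentLog3 under the exact KERNEL split
`algDescentLog3_iff_charSplit : AlgDescentAt Δ₁ ↔ D_char ∧ D_lef` (registered stub on item 23721,
landed p748078): IF per at depth Δ₁ = ⌊log₂⌊log₂⌊log₂ n⌋⌋⌋+1 beats every sign circuit with
polynomially many INTEGER ADVICE leaves of any height (the hypothesis of D) THEN for every exponent
c some per_n is hard over SOME prime field ZMod p (= road P, item 23779). NECESSARY (kernel, gen 6:
VH ⟹ P, `dChar_of_vh`, through the Lefschetz transfer T = `exists_complexCircuit_of_charSpread`).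
Content (contrapositive): ONE exponent serving EVERY prime field ⟹ integer-advice circuits over ℂ at
the same depth — a CRT / lifting of circuits ACROSS characteristics at fixed product-depth; nothing
of the kind is known (per ≡ det mod 2 shows small primes behave unlike ℂ). Tag
WEAKER·NEC·IDEA-NEEDED. Banked context: moot if the director re-glues the spine onto road P
(closes_PL needs only P, D_lef, B). [difficulty: open-problem] -/
@[route_item "route-ValiantsHypothesis-SuccinctLift"]
def DCharLog3 : Prop :=
  (¬ ∃ c : ℕ, ∀ n : ℕ, ∃ m : ℕ, m ≤ n ^ c + c ∧ ∃ a : Fin m → ℤ, ∃ C : Literature.Computability.AlgebraicComplexity.ArithCircuit ℤ (Fin (n * n) ⊕ Fin m), C.HasSignConstants ∧ ∃ C' : Literature.Computability.AlgebraicComplexity.ArithCircuit ℂ (Fin n × Fin n), C' = ((C.substVC (Sum.elim Sum.inl fun i => Sum.inr (a i))).map (Int.castRingHom ℂ)).rename ⇑(finProdFinEquiv (m := n) (n := n)).symm ∧ C'.Computes (Literature.Computability.AlgebraicComplexity.perPoly (Fin n) ℂ) ∧ C'.productDepth ≤ Nat.log 2 (Nat.log 2 (Nat.log 2 n)) + 1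 ∧ C'.edgeSize ≤ n ^ c + c) → ¬ ∃ c : ℕ, ∀ n p : ℕ, p.Prime → ∃ C : Literature.Computability.AlgebraicComplexity.ArithCircuit (ZMod p) (Fin n × Fin n), C.Computes (Literature.Computability.AlgebraicComplexity.perPoly (Fin n) (ZMod p)) ∧ C.productDepth ≤ Nat.log 2 (Nat.log 2 (Nat.log 2 n)) + 1 ∧ C.edgeSize ≤ n ^ c + c

-- `DCharLog3` holds: proved by `Summit.ValiantsHypothesis.ValiantsHypothesis.Theorems.SuccinctLiftCharTwo.dCharLog3_proof` (its module imports this route file, so no `_holds` link can be stated here).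

/-- item stmt-ValiantsHypothesis-25045 · aside · rank 1 · closed · proved by Summit.ValiantsHypothesis.ValiantsHypothesis.Theorems.SuccinctLiftCharTwo.succinctRungEngineLog3_proof (planner) · by planner
[aside] R_eng = the ENGINE-EDGE RUNG under crux A (gen 10, lens-2 «EngineCeiling»; PRINT-ANALYSIS —
neither a printed theorem nor kernel): for one absolute e and EVERY wire exponent a there is no
constant c such that every per_n has a sign-constant (constant-free integer) circuit of
product-depth ≤ ⌊log₂⌊log₂⌊log₂ n⌋⌋⌋+1 with ≤ n^a + c wires whose Kabanets–Impagliazzo code word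
`encodeArithCircuit` has a B₂-description circuit of ≤ 2^{⌊L/(M+2)^{e(a+1)}⌋} + c gates (L = ⌊log₂
n⌋, M = ⌊log₂ L⌋; eventual notch: wire exponent pinned, slack c free). This is the largest budget
shape on the succinctness dial that the Chen–Kabanets 2012 indirect diagonalisation (ECCC TR12-007:
Lemma 2.4 p7, Lemma 3.1 p8, Lemma 3.3 p9, Lemma 3.4/Claim 3.5 pp10–11, Cor 4.5 p12, composed as in
Lemma 4.9/Thm 4.10 p13) still certifies by the lens's parameter chase (g10/ENGINE.md §3: closing
inequality h(b·L·M^{θ(a)}) < L − 2M for descriptions of 2^{h(L)} gates, θ(a) = O(log a); satisfied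
at h = L/(log L)^{θ′}, θ′ > θ(a)). Placement, KERNEL (lens node v11): floor 23476 ⟸ R_eng ⟸ A 23651
(`floor_of_engine` via ⌊log₂ n⌋^k ≤ 2^{⌊L/(M+2)^E⌋} + K, `engine_of_A`), A ⟺ R_eng ∧ EngineLiftLog3
exactly (`A_iff_engine_and_ -/
@[route_item "route-ValiantsHypothesis-SuccinctLift"]
def SuccinctRungEngineLog3 : Prop :=
  ∃ e : ℕ, ∀ a : ℕ, ¬ ∃ c : ℕ, ∀ n : ℕ, ∃ C : Literature.Computability.AlgebraicComplexity.ArithCircuit ℤ (Fin (n * n)), ∃ C' : Literature.Computability.AlgebraicComplexity.ArithCircuit ℂ (Fin n × Fin n), C' = (C.map (Int.castRingHom ℂ)).rename ⇑(finProdFinEquiv (m := n) (n := n)).symm ∧ C.HasSignConstants ∧ C'.Computes (Literature.Computability.AlgebraicComplexity.perPoly (Fin n) ℂ) ∧ C'.productDepth ≤ Nat.log 2 (Nat.log 2 (Nat.log 2 n)) + 1 ∧ C'.edgeSize ≤ n ^ a + c ∧ ∃ w : ℕ, (Literature.Computability.AlgebraicComplexity.encodeArithCircuit (n * n) C).length ≤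 2 ^ w ∧ ∃ D : Literature.Computability.Complexity.Circuit (Fin w), D.IsOver Literature.Computability.Complexity.B2 ∧ D.size ≤ 2 ^ (Nat.log 2 n / (Nat.log 2 (Nat.log 2 n) + 2) ^ (e * (a + 1))) + c ∧ D.Computes fun x => (Literature.Computability.AlgebraicComplexity.encodeArithCircuit (n * n) C).getD (∑ t : Fin w, if x t then 2 ^ (t : ℕ) else 0) false

-- `SuccinctRungEngineLog3` holds: proved by `Summit.ValiantsHypothesis.ValiantsHypothesis.Theorems.SuccinctLiftCharTwo.succinctRungEngineLog3_proof` (its module imports this route file, so no `_holds` link can be stated here).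

/-- item stmt-ValiantsHypothesis-23558 · aside · rank 2 · closed · proved by Summit.ValiantsHypothesis.ValiantsHypothesis.Theorems.SuccinctLiftCharTwo.pinnedUniformityLiftLog3_proof (planner) · by planner
why it might fail: As U: no uniform→non-uniform lift is known for any explicit polynomial (locality barrier CHOPRS2020 for generic magnification); U′ is stronger than U by exactly PaddingLift; fails iff PER has CF depth-Δ₁ poly circuits but none with a small canonical-width description.
sources: CHOPRS2020, McKayMurrayWilliams2019, ChenKabanets2012, ChatterjeeTengse2023
[aside] U′ = wall U in PINNED form (gen 8): canonical-width (n+c)-succinct constant-free hardness of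
PER at product-depth Δ₁ ⟹ constant-free hardness at depth Δ₁ (the top notch `PerHardLog3CF`, 23654).
Kernel (lens §Gen 8): U′ ⟺ (A′ → PerHardLog3CF) (Iff.rfl); U′ ⟹ U; U ∧ PaddingLift ⟹ U′; VH ⟹ U′; A′
∧ U′ ⟺ PerHardLog3CF ⟺ A ∧ U; VH ⟺ A′ ∧ U′ ∧ K_alg ∧ B (`summit_iff_split_g8`); residual (A′ → VH) ⟺
U′ ∧ K_alg ∧ B. It is U with the padding question (a FORMAT lift: un-normalised witnesses) moved in
from the attack crux — the honest home of format/uniformity lifts. DECLARED-RESIDUAL candidate (wall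
1′); IDEA-NEEDED / BARRIER exactly as U (uniform → non-uniform lift in the description budget n+c ⟶
n^c+c; generic magnification meets the locality barrier). -/
@[route_item "route-ValiantsHypothesis-SuccinctLift"]
def PinnedUniformityLiftLog3 : Prop :=
  (¬ ∃ c : ℕ, ∀ n : ℕ, ∃ C : Literature.Computability.AlgebraicComplexity.ArithCircuit ℤ (Fin (n * n)), ∃ C' : Literature.Computability.AlgebraicComplexity.ArithCircuit ℂ (Fin n × Fin n), C' = (C.map (Int.castRingHom ℂ)).rename ⇑(finProdFinEquiv (m := n) (n := n)).symm ∧ C.HasSignConstants ∧ C'.Computes (Literature.Computability.AlgebraicComplexity.perPoly (Fin n) ℂ) ∧ C'.productDepth ≤ Nat.log 2 (Nat.log 2 (Nat.log 2 n)) + 1 ∧ C'.edgeSize ≤ n ^ c + c ∧ (Literature.Computability.AlgebraicComplexity.encodeArithCircuit (n * n) C).length ≤ 2 ^ (1 + Nat.log 2 (8 * (n * n + (n ^ c + c) + 27) ^ 2)) ∧ ∃ D : Literature.Computability.Complexity.Circuit (Fin (1 + Nat.log 2 (8 * (n * n + (n ^ c + c) + 27) ^ 2))), D.IsOver Literature.Computability.Complexity.B2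 ∧ D.size ≤ n + c ∧ D.Computes fun a => (Literature.Computability.AlgebraicComplexity.encodeArithCircuit (n * n) C).getD (∑ t : Fin (1 + Nat.log 2 (8 * (n * n + (n ^ c + c) + 27) ^ 2)), if a t then 2 ^ (t : ℕ) else 0) false) → ¬ ∃ c : ℕ, ∀ n : ℕ, ∃ C : Literature.Computability.AlgebraicComplexity.ArithCircuit ℤ (Fin (n * n)), ∃ C' : Literature.Computability.AlgebraicComplexity.ArithCircuit ℂ (Fin n × Fin n), C' = (C.map (Int.castRingHom ℂ)).rename ⇑(finProdFinEquiv (m := n) (n := n)).symm ∧ C.HasSignConstants ∧ C'.Computes (Literature.Computability.AlgebraicComplexity.perPoly (Fin n) ℂ) ∧ C'.productDepth ≤ Nat.log 2 (Nat.log 2 (Nat.log 2 n)) + 1 ∧ C'.edgeSize ≤ n ^ c + c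

-- `PinnedUniformityLiftLog3` holds: proved by `Summit.ValiantsHypothesis.ValiantsHypothesis.Theorems.SuccinctLiftCharTwo.pinnedUniformityLiftLog3_proof` (its module imports this route file, so no `_holds` link can be stated here).

/-- item stmt-ValiantsHypothesis-23780 · aside · rank 2 · open · by planner
why it might fail: Equivalent to PerHardLog3 modulo the Nullstellensatz (print): fails iff per has depth-Δ₁ poly-wire circuits over ℂ, i.e. iff lens-4's crux fails; no finite-field lower bound for per above slope 1/2 is known.
sources: BurgisserClausenShokrollahi1997, Burgisser2000, Forbes2024LowDepth, LimayeSrinivasanTavenas2025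
[aside] P^cof (gen 5; gen 6 update) = `PerHardCofiniteChar Δ₁` of
Theorems/SuccinctLiftFiniteFields.lean (p746038): for every exponent c some per_n is hard at product
depth Δ₁ with n^c+c wires over EVERY finite field whose characteristic is prime to some N ≠ 0.
EQUIVALENT TO lens-4's crux PerHardLog3 — KERNEL BOTH WAYS since gen 6:
`perHardCofiniteCharLog3_iff_perHardLog3 : P^cof ↔ PerHardLog3`
(Theorems/SuccinctLiftLefschetz.lean, p748078, commit ce16de410abe). (⟹, p746038) the skeleton-exact
REDUCTION TO POSITIVE CHARACTERISTIC `exists_finiteFieldConstants` (constants of a ℂ-circuit for an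
integer polynomial live in a finitely generated ℤ-algebra A ⊂ ℂ and A[1/N] has a finite residue
field — `Literature.GroupTheory.ArithmeticGroups.finite_quotient_of_isMaximal`); (⟸, p748078) the
LEFSCHETZ TRANSFER `exists_complexCircuit_of_charSpread` (finitely many skeletons of given size
`Bookkeeping.finite_skeletons_of_fanIn_le`; a skeleton realised in unboundedly many characteristics
has, by pigeonhole and `exists_ringHom_complex_of_charSpread` = Zariski/Jacobson over ℤ +
transcendence degree of ℂ, a realisation over ℂ). Hence P^cof is an exact ROTATION of PerHardLog3
into finite-field coord -/
@[route_item "route-ValiantsHypothesis-SuccinctLift"]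
def PerHardCofiniteCharLog3 : Prop :=
  ∀ c : ℕ, ∃ n N : ℕ, N ≠ 0 ∧ ∀ (F : Type) [Field F] [Fintype F], (N : F) ≠ 0 → ¬ ∃ C : Literature.Computability.AlgebraicComplexity.ArithCircuit F (Fin n × Fin n), C.Computes (Literature.Computability.AlgebraicComplexity.perPoly (Fin n) F) ∧ C.productDepth ≤ Nat.log 2 (Nat.log 2 (Nat.log 2 n)) + 1 ∧ C.edgeSize ≤ n ^ c + c

/-- item stmt-ValiantsHypothesis-23865 · aside · rank 2 · open · by planner
why it might fail: Implied by PerHardLog3, so it fails only if per is easy over ℂ at depth Δ₁ yet hard modulo some prime for every exponent (e.g. det hard over F_2 at depth Δ₁ while VP = VNP over ℂ) — consistent with everything known; no fixed-depth lifting from ZMod p to characteristic 0 exists.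
sources: Burgisser2000, BurgisserClausenShokrollahi1997, Forbes2024LowDepth, LimayeSrinivasanTavenas2025
[aside] D_lef (gen 6) = `DLef Δ₁` of Theorems/SuccinctLiftLefschetz.lean (p748078): the LIFTING half
of wall D under the exact kernel split `algDescentLog3_iff_charSplit`; statement: road P (item
23779: for every c some per_n is hard over SOME prime field) ⟹ per is hard at depth Δ₁ over Q̄
(equivalently over ℂ, `dLef_iff`; i.e. P ⟹ PerHardLog3). NECESSARY (kernel: `dLef_of_vh`); any proof
of lens-4's crux PerHardLog3 proves it (`dLef_of_not_perEasyComplex`). With it the summit splits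
EXACTLY into three necessary pieces, kernel: `vh_iff_somePrime_lef_collapseLog3 : VH ↔ P ∧ D_lef ∧
CollapseLog3`; the alternative deciding theorem `closes_PL (hP : PerHardSomePrimeLog3) (hL :
DLefLog3) (hB : CollapseLog3)` is certified in the lens node g6/gluePL.lean and NOT applied (spine
of record unchanged; director call). Content: a Q̄-circuit reduces modulo all but finitely many
primes to circuits over finite fields F_q with the same skeleton (kernel, g5
`exists_finiteField_computes_perPoly`) but NOT to PRIME fields nor to EVERY prime: the gap is (i)
descent F_(p^k) → F_p at constant product-depth and (ii) the finitely many bad primes (e.g. p = 2,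
where per = det). BRIDGE-type piece (pattern T ∧ ( -/
@[route_item "route-ValiantsHypothesis-SuccinctLift"]
def DLefLog3 : Prop :=
  (¬ ∃ c : ℕ, ∀ n p : ℕ, p.Prime → ∃ C : Literature.Computability.AlgebraicComplexity.ArithCircuit (ZMod p) (Fin n × Fin n), C.Computes (Literature.Computability.AlgebraicComplexity.perPoly (Fin n) (ZMod p)) ∧ C.productDepth ≤ Nat.log 2 (Nat.log 2 (Nat.log 2 n)) + 1 ∧ C.edgeSize ≤ n ^ c + c) → ¬ ∃ c : ℕ, ∀ n : ℕ, ∃ C : Literature.Computability.AlgebraicComplexity.ArithCircuit ↥(algebraicClosure ℚ ℂ) (Fin n × Fin n), C.Computes (Literature.Computability.AlgebraicComplexity.perPoly (Fin n) ↥(algebraicClosure ℚ ℂ)) ∧ C.productDepth ≤ Nat.log 2 (Nat.log 2 (Nat.log 2 n)) + 1 ∧ C.edgeSize ≤ n ^ c + c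

/-- item stmt-ValiantsHypothesis-25046 · aside · rank 2 · closed · proved by Summit.ValiantsHypothesis.ValiantsHypothesis.Theorems.SuccinctLiftCharTwo.engineLiftLog3_proof (planner) · by planner
[aside] W_eng = the DESCRIPTION LIFT below crux A (gen 10, lens-2 «EngineCeiling»): engine-edge
hardness R_eng (aside SuccinctRungEngineLog3) ⟹ A, i.e. hardness of per against depth-Δ₁
sign-constant poly-wire circuits with descriptions of 2^{L/(log L)^{O_a(1)}} gates LIFTS to hardness
against descriptions of n + c gates, at the same wires and depth. EXACTLY the part of A outside the
Chen–Kabanets engine: A ⟺ R_eng ∧ W_eng (kernel `A_iff_engine_and_lift`); NEC (VH ⟹ W_eng,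
`engineLift_of_vh`); IDEA-NEEDED: at budget n + c the engine's first failing hypothesis is Lemma
3.1's advice bound α(n) ∈ o(n) (TR12-007 p8; the line "µ(n) ≤ n^{o(1)} ≤ n/log² n" of Lemmas 4.1/4.9
pp11,13) evaluated at the Claim-3.5-stretched length, µ(n) ≥ 2^{h(b·L·M^{θ(a)})} ≫ n — scale-free in
the diagonaliser's time bound, alternations and hierarchy sharpness (g10/ENGINE.md §4); crossing it
means not charging the description against the diagonaliser's input length, i.e. a non-uniform lower
bound for the stretched class — wall U's technique class (Santhanam–Williams 2014 Prop 2.1 vs Thm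
2.5: sublinear advice unconditional, 2^{εn} advice only a gap theorem; locality barrier CHOPRS2020
for the generic magnificat -/
@[route_item "route-ValiantsHypothesis-SuccinctLift"]
def EngineLiftLog3 : Prop :=
  (∃ e : ℕ, ∀ a : ℕ, ¬ ∃ c : ℕ, ∀ n : ℕ, ∃ C : Literature.Computability.AlgebraicComplexity.ArithCircuit ℤ (Fin (n * n)), ∃ C' : Literature.Computability.AlgebraicComplexity.ArithCircuit ℂ (Fin n × Fin n), C' = (C.map (Int.castRingHom ℂ)).rename ⇑(finProdFinEquiv (m := n) (n := n)).symm ∧ C.HasSignConstants ∧ C'.Computes (Literature.Computability.AlgebraicComplexity.perPoly (Fin n) ℂ) ∧ C'.productDepth ≤ Nat.log 2 (Nat.log 2 (Nat.log 2 n)) + 1 ∧ C'.edgeSize ≤ n ^ a + c ∧ ∃ w : ℕ, (Literature.Computability.AlgebraicComplexity.encodeArithCircuit (n * n) C).length ≤ 2 ^ w ∧ ∃ D : Literature.Computability.Complexity.Circuit (Fin w), D.IsOver Literature.Computability.Complexity.B2 ∧ D.size ≤ 2 ^ (Nat.log 2 n / (Nat.log 2 (Nat.log 2 n) + 2) ^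 (e * (a + 1))) + c ∧ D.Computes fun x => (Literature.Computability.AlgebraicComplexity.encodeArithCircuit (n * n) C).getD (∑ t : Fin w, if x t then 2 ^ (t : ℕ) else 0) false) → ¬ ∃ c : ℕ, ∀ n : ℕ, ∃ C : Literature.Computability.AlgebraicComplexity.ArithCircuit ℤ (Fin (n * n)), ∃ C' : Literature.Computability.AlgebraicComplexity.ArithCircuit ℂ (Fin n × Fin n), C' = (C.map (Int.castRingHom ℂ)).rename ⇑(finProdFinEquiv (m := n) (n := n)).symm ∧ C.HasSignConstants ∧ C'.Computes (Literature.Computability.AlgebraicComplexity.perPoly (Fin n) ℂ) ∧ C'.productDepth ≤ Nat.log 2 (Nat.log 2 (Nat.log 2 n)) + 1 ∧ C'.edgeSize ≤ n ^ c + c ∧ ∃ w : ℕ, (Literature.Computability.AlgebraicComplexity.encodeArithCircuit (n * n) C).length ≤ 2 ^ w ∧ ∃ D : Literature.Computability.Complexity.Circuit (Fin w), D.IsOver Literature.Computability.Complexity.B2 ∧ D.size ≤ n + c ∧ D.Computes fun a => (Literature.Computability.AlgebraicComplexity.encodeArithCircuit (n * n) C).getD (∑ t : Fin w, if a t then 2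 ^ (t : ℕ) else 0) false

-- `EngineLiftLog3` holds: proved by `Summit.ValiantsHypothesis.ValiantsHypothesis.Theorems.SuccinctLiftCharTwo.engineLiftLog3_proof` (its module imports this route file, so no `_holds` link can be stated here).

/-- item stmt-ValiantsHypothesis-28333 · aside · rank 3 · closed · proved by Summit.ValiantsHypothesis.ValiantsHypothesis.Theorems.SuccinctLiftCharTwo.boolBridgeF2_proof (planner) · by planner
[aside · RESTORED rev 19 as a plain definition — PROVED child of P = PerHardSomePrimeLog3 (closed
04:33:54Z, children moot-by-parent); kept so that the ACCEPTED Theorems files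
SuccinctLiftCharTwo{,Arith,Majority,Bridge}.lean that state/prove it BY NAME elaborate
(ops-buildfix-3 G34-N3)] [crux · T2 · the arithmetic-F2 -> Boolean AC0[parity] bridge, formula
accounting] For every arithmetic circuit C over ZMod 2 (variables re-indexed by Fin M along e) of
product-depth <= Δ with <= s wires, the Boolean function x ↦ [value of C's output polynomial at the
0/1 point x is 1] is realizable over accBasis 2 = {¬, ∧, ∨, MOD2} at acDepth <= 2Δ+2 with <=
(2s+3)^(2Δ+2) gates: collapse every maximal chain of sum gates into ONE parity gate over its atoms
(inputs / constants / product gates), products become ∧; forward gate references carry the junk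
value 0 (= constant false); constants cost depth 1. TRUE (folklore); load-bearing stub of line char2
for P (stmt 23779); size L (induction on the gate list over the ACRealizeOver toolkit). -/
@[route_item "route-ValiantsHypothesis-SuccinctLift"]
def BoolBridgeF2 : Prop :=
  ∀ (M : ℕ) (σ : Type) (e : Fin M ≃ σ) (C : Literature.Computability.AlgebraicComplexity.ArithCircuit (ZMod 2) σ) (Δ s : ℕ), C.productDepth ≤ Δ → C.edgeSize ≤ s → Literature.Computability.Complexity.ACRealOver (Literature.Computability.Complexity.accBasis 2) (fun x : Fin M → Bool => decide (MvPolynomial.eval (fun i : σ => if x (e.symm i) then (1 : ZMod 2) else 0) C.eval = 1)) (2 * Δ + 2) ((2 * s + 3) ^ (2 * Δ + 2))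

-- `BoolBridgeF2` holds: proved by `Summit.ValiantsHypothesis.ValiantsHypothesis.Theorems.SuccinctLiftCharTwo.boolBridgeF2_proof` (its module imports this route file, so no `_holds` link can be stated here).

/-- item stmt-ValiantsHypothesis-28334 · aside · rank 3 · closed · proved by Summit.ValiantsHypothesis.ValiantsHypothesis.Theorems.SuccinctLiftCharTwo.majorityPermanentMod2_proof (planner) · by planner
[aside · RESTORED rev 19 as a plain definition — PROVED child of P = PerHardSomePrimeLog3 (closed
04:33:54Z, children moot-by-parent); kept so that the ACCEPTED Theorems files
SuccinctLiftCharTwo{,Arith,Majority,Bridge}.lean that state/prove it BY NAME elaborate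
(ops-buildfix-3 G34-N3)] [support · T3 · MAJORITY is a literal projection of the permanent mod 2]
For every k there are m <= (k+2)^2 and an m×m matrix of literals/constants (entry inl b = constant
b, inr (i,true) = x_i, inr (i,false) = ¬x_i) whose permanent over ZMod 2 is the indicator of
majorityFn k: counting branching program on states (j, #ones) ∈ Fin (k+1) × Fin (k+1) plus a sink t,
self-loops on every state except s = (0,0), transitions (j,c)→(j+1,c) labelled ¬x_j and
(j,c)→(j+1,c+1) labelled x_j, accepting edges (k,c)→t for 2c >= k, back edge t→s; the unique cycle
cover of non-zero weight is the input-consistent s–t path closed up (Valiant 1979 universality).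
TRUE over ℕ already; verified by exact permanents for k <= 5 and mod 2 for k <= 7
(HOME/decomp-val-lens-2/g11/t3_check.py). Size M (List.formPerm of the path + a downward induction
on levels for uniqueness). -/
@[route_item "route-ValiantsHypothesis-SuccinctLift"]
def MajorityPermanentMod2 : Prop :=
  ∀ k : ℕ, ∃ m : ℕ, m ≤ (k + 2) ^ 2 ∧ ∃ E : Fin m × Fin m → Bool ⊕ (Fin k × Bool), ∀ x : Fin k → Bool, (Matrix.of fun i j : Fin m => if Sum.elim (fun b : Bool => b) (fun ip : Fin k × Bool => if ip.2 then x ip.1 else !x ip.1) (E (i, j)) then (1 : ZMod 2) else 0).permanent = if Literature.Computability.MetaComplexity.Smolensky.majorityFn k x then 1 else 0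

-- `MajorityPermanentMod2` holds: proved by `Summit.ValiantsHypothesis.ValiantsHypothesis.Theorems.SuccinctLiftCharTwo.majorityPermanentMod2_proof` (its module imports this route file, so no `_holds` link can be stated here).

/-- item stmt-ValiantsHypothesis-28335 · aside · rank 3 · closed · proved by Summit.ValiantsHypothesis.ValiantsHypothesis.Theorems.SuccinctLiftCharTwo.smolenskyBeatsLog3_proof (planner) · by planner
[aside · RESTORED rev 19 as a plain definition — PROVED child of P = PerHardSomePrimeLog3 (closed
04:33:54Z, children moot-by-parent); kept so that the ACCEPTED Theorems files
SuccinctLiftCharTwo{,Arith,Majority,Bridge}.lean that state/prove it BY NAME elaborate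
(ops-buildfix-3 G34-N3)] [support · T4 · elementary asymptotics: the Razborov–Smolensky exponent
beats the Δ₁ size budget] For every c there are an odd k and ℓ >= 1 with 64·ℓ^(2(2Δ₁(m)+3)) <= k and
8·((2(m^c+c)+3)^(2Δ₁(m)+2) + m²) < 2^ℓ for all m <= (k+2)², Δ₁(m) = ⌊log₂⌊log₂⌊log₂ m⌋⌋⌋+1. Witness:
t = c+5, N = 2^(2^t), k = 2^N − 1, ℓ = 2^(2^(2^t − t − 4)); then Δ₁(m) <= t+2 (Nat.log monotone,
Nat.log_pow), 6 + 2^(2^t−t−4)(4t+14) <= N−1, and log₂ of the size bound <= 2^(2^t+t+1) < ℓ. Pure ℕ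
arithmetic; INSTRUMENTABLE. -/
@[route_item "route-ValiantsHypothesis-SuccinctLift"]
def SmolenskyBeatsLog3 : Prop :=
  ∀ c : ℕ, ∃ k : ℕ, Odd k ∧ ∃ ℓ : ℕ, 1 ≤ ℓ ∧ ∀ m : ℕ, m ≤ (k + 2) ^ 2 → 64 * ((2 - 1) * ℓ) ^ (2 * (2 * (Nat.log 2 (Nat.log 2 (Nat.log 2 m)) + 1) + 2 + 1)) ≤ k ∧ 8 * ((2 * (m ^ c + c) + 3) ^ (2 * (Nat.log 2 (Nat.log 2 (Nat.log 2 m)) + 1) + 2) + m * m) < 2 ^ ℓ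

-- `SmolenskyBeatsLog3` holds: proved by `Summit.ValiantsHypothesis.ValiantsHypothesis.Theorems.SuccinctLiftCharTwo.smolenskyBeatsLog3_proof` (its module imports this route file, so no `_holds` link can be stated here).

/-- item stmt-ValiantsHypothesis-28336 · aside · rank 3 · closed · proved by Summit.ValiantsHypothesis.ValiantsHypothesis.Theorems.SuccinctLiftCharTwo.perHardSomePrimeLog3Glue_proof (planner) · by planner
[aside · RESTORED rev 19 as a plain definition — the glue of the (moot-by-parent) char-2 split of P,
PROVED by Theorems/SuccinctLiftCharTwo.lean `perHardSomePrimeLog3Glue_proof` (p760633-series), which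
is ALSO the proof of record of P; kept so that file elaborates (ops-buildfix-3 G34-N3)] char-2 line
(g11): take p = 2; compose the purported F2-circuits for per_m (m from T3) with the literal matrix
of T3 via ACRealOver.comp, extract a Boolean accBasis-2 circuit computing majorityFn k at acDepth
2Δ₁(m)+3 and size ≤ (2(m^c+c)+3)^(2Δ₁(m)+2) + m² (ACRealOver.toCircuit), and contradict the tree's
PROVED Smolensky.smolensky_majority (p = 2). -/
@[route_item "route-ValiantsHypothesis-SuccinctLift"]
def PerHardSomePrimeLog3Glue : Prop :=
  BoolBridgeF2 → MajorityPermanentMod2 → SmolenskyBeatsLog3 → PerHardSomePrimeLog3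

-- `PerHardSomePrimeLog3Glue` holds: proved by `Summit.ValiantsHypothesis.ValiantsHypothesis.Theorems.SuccinctLiftCharTwo.perHardSomePrimeLog3Glue_proof` (its module imports this route file, so no `_holds` link can be stated here).

/-- item stmt-ValiantsHypothesis-23653 · aside · rank 4 · open · by planner
why it might fail: Equivalent to AlgConstantLiftLog3 (kernel); fails iff algebraic constants shorten per at depth Δ₁.
sources: Burgisser2000, Koiran2004, KoiranPerifel2011, Burgisser2009
[crux] K (declared-RESIDUAL factor 2, IDEA-NEEDED leaf, WEAKER — kernel `constantLiftLog3_of_vh`):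
if per has no constant-free (sign constants, integer) depth-Δ₁ poly-wire circuits then it has no
depth-Δ₁ poly-wire circuits over ℂ with arbitrary constants, i.e. lens-4's `PerHardLog3`. Constant
elimination at FIXED product-depth for the permanent; `perHardLog3_iff_split3 : PerHardLog3 ↔ A ∧ U
∧ K` (kernel, no hypothesis). [difficulty: open-problem] -/
@[route_item "route-ValiantsHypothesis-SuccinctLift"]
def ConstantLiftLog3 : Prop :=
  (¬ ∃ c : ℕ, ∀ n : ℕ, ∃ C : Literature.Computability.AlgebraicComplexity.ArithCircuit ℤ (Fin (n * n)), ∃ C' : Literature.Computability.AlgebraicComplexity.ArithCircuit ℂ (Fin n × Fin n), C' = (C.map (Int.castRingHom ℂ)).rename ⇑(finProdFinEquiv (m := n) (n := n)).symm ∧ C.HasSignConstants ∧ C'.Computes (Literature.Computability.AlgebraicComplexity.perPoly (Fin n) ℂ) ∧ C'.productDepth ≤ Nat.log 2 (Nat.log 2 (Nat.log 2 n)) + 1 ∧ C'.edgeSize ≤ n ^ c + c) → ¬ ∃ c : ℕ, ∀ n : ℕ, ∃ C : Literature.Computability.AlgebraicComplexity.ArithCircuit ℂ (Fin n × Fin n),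 C.Computes (Literature.Computability.AlgebraicComplexity.perPoly (Fin n) ℂ) ∧ C.productDepth ≤ Nat.log 2 (Nat.log 2 (Nat.log 2 n)) + 1 ∧ C.edgeSize ≤ n ^ c + c

/-- item stmt-ValiantsHypothesis-23549 · aside · rank 9 · open · by planner
sources: LimayeSrinivasanTavenas2025, BhargavDuttaSaxena2024
[crux] A (ATTACKABLE leaf, WEAKER): for no constant c does every per_n have an unbounded-fan-in
arithmetic circuit over ℂ of product-depth ≤ ⌊log₂⌊log₂⌊log₂ n⌋⌋⌋ + 1 with at most n^c + c wires
(edge size, the size measure of LST 2021 §2). Equivalently: superpolynomial lower bound for the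
permanent at product-depth log log log n. Necessary for VH (kernel modulo the binarisation lemma
`BinarisationBound`, `perHardLog3_of_vh`); strictly weaker: implied by hardness of IMM ∈ VP at that
depth, not known to give VH. [difficulty: L] -/
@[route_item "route-ValiantsHypothesis-SuccinctLift"]
def PerHardLog3 : Prop :=
  ¬ ∃ c : ℕ, ∀ n : ℕ, ∃ C : Literature.Computability.AlgebraicComplexity.ArithCircuit ℂ (Fin n × Fin n), C.Computes (Literature.Computability.AlgebraicComplexity.perPoly (Fin n) ℂ) ∧ C.productDepth ≤ Nat.log 2 (Nat.log 2 (Nat.log 2 n)) + 1 ∧ C.edgeSize ≤ n ^ c + c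

/-- item stmt-ValiantsHypothesis-23654 · aside · rank 9 · closed · proved by Summit.ValiantsHypothesis.ValiantsHypothesis.Theorems.SuccinctLiftCharTwo.perHardLog3CF_proof (planner) · by planner
sources: KoiranPerifel2011, Koiran2004, ChatterjeeTengse2023
[support] the constant-free intermediate (banked context): per has no integer sign-constant depth-Δ₁
poly-wire circuits; `perHardLog3CF_iff_split2 : PerHardLog3CF ↔ SuccinctPerHardLog3 ∧
UniformityLiftLog3`; attack lines of its own: τ-methods / succinct hitting sets for univariates
(Jansen–Santhanam 2012 via ChatterjeeTengse2023-type transfer), BSS transfer. GEN 7 (KERNEL,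
Theorems/SuccinctLiftDescriptionDial.lean p751223, `perHardLog3CF_iff_polySuccinctHard`; lens
`perHardLog3CF_iff_top`): PerHardLog3CF IS THE TOP NOTCH β = n^c+c of the description dial
`PerHardDesc β Δ₁ := ¬ PerEasySuccinctCF β Δ₁` — at polynomial description budget succinctness is
free (constant-free normal form `exists_normalForm_signConst` + code length ≤ 8(N+e+27)² + table
circuits, Theorems/SuccinctLiftCircuitCodes.lean p750834); so A (notch n+c) and this item are two
notches of ONE typed family and U is the gap between them. Necessary for VH (kernel
`perHardLog3CF_of_perHardLog3`). [difficulty: open-problem] -/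
@[route_item "route-ValiantsHypothesis-SuccinctLift"]
def PerHardLog3CF : Prop :=
  ¬ ∃ c : ℕ, ∀ n : ℕ, ∃ C : Literature.Computability.AlgebraicComplexity.ArithCircuit ℤ (Fin (n * n)), ∃ C' : Literature.Computability.AlgebraicComplexity.ArithCircuit ℂ (Fin n × Fin n), C' = (C.map (Int.castRingHom ℂ)).rename ⇑(finProdFinEquiv (m := n) (n := n)).symm ∧ C.HasSignConstants ∧ C'.Computes (Literature.Computability.AlgebraicComplexity.perPoly (Fin n) ℂ) ∧ C'.productDepth ≤ Nat.log 2 (Nat.log 2 (Nat.log 2 n)) + 1 ∧ C'.edgeSize ≤ n ^ c + c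

-- `PerHardLog3CF` holds: proved by `Summit.ValiantsHypothesis.ValiantsHypothesis.Theorems.SuccinctLiftCharTwo.perHardLog3CF_proof` (its module imports this route file, so no `_holds` link can be stated here).

/-- item stmt-ValiantsHypothesis-23657 · aside · rank 9 · open · by planner
sources: Burgisser2000, ChenKabanets2012
[support] this node's own residual (banked context): if VP_ℂ = VNP_ℂ then per has (n+c)-succinct
constant-free depth-Δ₁ poly-wire circuits; kernel: `succinctCollapseLog3_iff_residual :
SuccinctCollapseLog3 ↔ (SuccinctPerHardLog3 → VH)` and `succinctCollapseLog3_iff_walls' :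
SuccinctCollapseLog3 ↔ UniformityLiftLog3 ∧ ConstantLiftLog3 ∧ CollapseLog3`. [difficulty:
open-problem] -/
@[route_item "route-ValiantsHypothesis-SuccinctLift"]
def SuccinctCollapseLog3 : Prop :=
  Literature.Computability.AlgebraicComplexity.VP ℂ = Literature.Computability.AlgebraicComplexity.VNP ℂ → ∃ c : ℕ, ∀ n : ℕ, ∃ C : Literature.Computability.AlgebraicComplexity.ArithCircuit ℤ (Fin (n * n)), ∃ C' : Literature.Computability.AlgebraicComplexity.ArithCircuit ℂ (Fin n × Fin n), C' = (C.map (Int.castRingHom ℂ)).rename ⇑(finProdFinEquiv (m := n) (n := n)).symm ∧ C.HasSignConstants ∧ C'.Computes (Literature.Computability.AlgebraicComplexity.perPoly (Fin n) ℂ) ∧ C'.productDepth ≤ Nat.log 2 (Nat.log 2 (Nat.log 2 n)) + 1 ∧ C'.edgeSize ≤ n ^ c + c ∧ ∃ w : ℕ, (Literature.Computability.AlgebraicComplexity.encodeArithCircuit (n * n) C).length ≤ 2 ^ w ∧ ∃ D : Literature.Computability.Complexity.Circuit (Fin w), D.IsOver Literature.Computability.Complexity.B2 ∧ D.size ≤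 n + c ∧ D.Computes fun a => (Literature.Computability.AlgebraicComplexity.encodeArithCircuit (n * n) C).getD (∑ t : Fin w, if a t then 2 ^ (t : ℕ) else 0) false

/-- item stmt-ValiantsHypothesis-23658 · assembly · rank 1 · closed · proved by Summit.ValiantsHypothesis.ValiantsHypothesis.Theorems.SuccinctLiftAssembly.assembly_holds (planner) · by planner
sources: Burgisser2000
[assembly] pure logic (the deciding theorem is glue.lean `closes`, same shape): assume VP ℂ = VNP ℂ;
B gives poly-wire depth-Δ₁ circuits over ℂ for per; K applied to (U applied to A) is exactly
lens-4's PerHardLog3, which refutes them. [deps: SuccinctPerHardLog3, UniformityLiftLog3,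
ConstantLiftLog3, CollapseLog3] [difficulty: S] -/
@[route_item "route-ValiantsHypothesis-SuccinctLift"]
def Assembly : Prop :=
  SuccinctPerHardLog3 → UniformityLiftLog3 → ConstantLiftLog3 → CollapseLog3 → _root_.ValiantsHypothesis

-- `Assembly` holds: proved by `Summit.ValiantsHypothesis.ValiantsHypothesis.Theorems.SuccinctLiftAssembly.assembly_holds` (its module imports this route file, so no `_holds` link can be stated here).

/-! D-0027 §2.1 — DECIDING THEOREM (planner-authored via `route open/edit --closes-file`; by planner-decomp-val-lens-2-g3-0 2026-08-29T19:54:03Z):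
its hypotheses are this route's items and its conclusion the sub-problem Statement (glue_lint), and it elaborates with this file. -/

@[closes "route-ValiantsHypothesis-SuccinctLift"] theorem closes (hA : SuccinctPerHardLog3) (hU : UniformityLiftLog3) (hK : AlgConstantLiftLog3)
    (hB : CollapseLog3) : _root_.ValiantsHypothesis := by
  show Literature.Computability.AlgebraicComplexity.VP ℂ ≠ Literature.Computability.AlgebraicComplexity.VNP ℂ
  intro hEq
  exact hK (hU hA)
    ((Summit.ValiantsHypothesis.ValiantsHypothesis.Theorems.SuccinctLift.perInDepthPoly_iff_algebraic
      (fun n => Nat.log 2 (Nat.log 2 (Nat.log 2 n)) + 1)).mp (hB hEq))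

end Summit.ValiantsHypothesis.ValiantsHypothesis.Theses.SuccinctLift
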